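import Literature.NumberTheory.LFunctions.NymanBeurlingVectorsHigher
import Literature.NumberTheory.LFunctions.NymanBeurlingVectorsAsymptotics
import Literature.NumberTheory.LFunctions.NymanBeurlingVectorsOrthogonal
import Mathlib.MeasureTheory.Integral.Prod
import HarnessLib

/-!
# Asymptotics of Burnol's higher vectors: pairings with `χ` and Gram matrix

Continuation of `Literature/NumberTheory/LFunctions/NymanBeurlingVectorsHigher.lean` (Burnol 2002,
§5, Theorems 5.2–5.3 for the data `K_k = burnolKk ρ k λ`, on the Mellin side). With
`s = 1/2 + iτ`, `ρ = 1/2 + iγ`, `0 < λ < 1`, `L = log(1/λ)`, `w(τ) = |r(s)|²` (`wR`) and the scaled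
model `M_k = L^{k+1} Φ_k(L(s-ρ)) = (-1)^k ∫_0^L y^k e^{(s-ρ)y} dy` (`Mk`, `Mk_eq_integral`):

* **Pairings with `χ`** (`𝓜χ = 1/s`; Thm. 5.3): `∫ K_0(s)/s dτ → -2π(ρ-1)/ρ⁵`
  (`tendsto_integral_burnolKk_zero_div`, from the tree's `k = 0` limits and `K_0 = -burnolK`) and
  `L^{-(k+1)} ∫ K_{k+1}(s)/s dτ → 0` (`tendsto_integral_burnolKk_succ_div`): by the recurrence
  `(s-ρ)M_{k+1} = (k+1)M_k + (-L)^{k+1}e^{L(s-ρ)}`,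
  `K_{k+1}/s = -(k+1)!(r/s)Z_{k+1} - (r/s)M_{k+1} - (k+1)(r/s)W̃M_k - (-L)^{k+1}k₂/s`
  (`W̃ = (W-1)/(s-ρ)` bounded), the four pieces being constant, bounded (Fubini and Mellin inversion
  for the tree's `fLog`: `∫ (r/s)M_k = (-1)^k ∫_0^L y^k e^{-ρy} 2πf(e^{-y}) dy`,
  `norm_integral_burnolR_div_mul_Mk_le`), `o(L^{k+1})` by dominated convergence, and `L^{k+1}·o(1)`
  by Riemann–Lebesgue (the tree's `tendsto_integral_burnolK2_div`).
* **Gram matrix** (Thm. 5.2): `L^{-(k+l+1)} ∫ conj(K_{ρ,k}) K_{ρ,l} dτ → w(γ)(-1)^{k+l} 2π/(k+l+1)`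
  (`tendsto_integral_conj_burnolKk_mul_burnolKk`) — main term by the substitution `τ = γ + y/L`,
  dominated convergence and the constants `∫ conj(Φ_k(iy))Φ_l(iy) dy = (-1)^{k+l}2π/(k+l+1)`
  (`integral_conj_phiK_mul_phiK`, Parseval for `𝟙_{[0,1]}x^k` obtained by polarising the tree's
  Plancherel theorem `Literature.Analysis.FunctionSpaces.integral_norm_sq_fourierIntegral_eq`); for
  distinct zeros the normalised cross terms tend to `0`
  (`tendsto_integral_conj_burnolKk_mul_burnolKk_of_ne`, dominated convergence with the tree's
  `cross_bound_aux`). These are the continuous counterparts of Burnol's Cauchy blocks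
  `(1/(i+j+1))`.
* **Parseval for two inverse Mellin transforms** of `L¹ ∩ L²` line data
  (`integral_mellinInv_mul_conj_mellinInv`, polarising the tree's `integral_norm_sq_mellinInv`).

## References

* J.-F. Burnol, *A lower bound in an approximation problem involving the zeros of the Riemann
  zeta function*, Adv. Math. 170 (2002), 56–70; arXiv:math/0103058, §2, Thms. 5.2, 5.3.
* E. C. Titchmarsh, *Introduction to the Theory of Fourier Integrals*, 2nd ed., Oxford 1948,
  Thm. 48 (Plancherel), Thms. 71–72 (Parseval for Mellin transforms).
-/

noncomputable section

open Complex Filter MeasureTheory Set Asymptotics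
open scoped Real Topology ComplexConjugate Nat

namespace Literature.NumberTheory.LFunctions

namespace BurnolVectors

/-! ## 1. The scaled model `M_k = L^{k+1} Φ_k(L(s-ρ))` on the critical line -/

/-- `s - ρ = i(τ - γ)` on the line. [folklore] -/
lemma line_sub_line_eq (τ γ : ℝ) :
    ((1 / 2 : ℂ) + τ * I) - ((1 / 2 : ℂ) + γ * I) = ((τ - γ : ℝ) : ℂ) * I := by
  push_cast; ring

/-- `M_k` as `L^{k+1} Φ_k(i L (τ-γ))`. [folklore] -/
theorem Mk_eq (k : ℕ) (lam γ τ : ℝ) :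
    Mk k lam γ τ = (Lof lam : ℂ) ^ (k + 1) * phiK k (((Lof lam * (τ - γ) : ℝ) : ℂ) * I) := by
  rw [Mk, line_sub_line_eq]
  congr 2
  push_cast
  ring

/-- `K_k = -r (k! Z_k + W M_k)` on the line (definitional regrouping). [folklore] -/
theorem burnolKk_line_eq (γ : ℝ) (k : ℕ) (lam τ : ℝ) :
    burnolKk ((1 / 2 : ℂ) + γ * I) k lam ((1 / 2 : ℂ) + τ * I) =
      -burnolR ((1 / 2 : ℂ) + τ * I) * (k ! * Zk ((1 / 2 : ℂ) + γ * I) k ((1 / 2 : ℂ) + τ * I) +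
        Wf ((1 / 2 : ℂ) + γ * I) ((1 / 2 : ℂ) + τ * I) * Mk k lam γ τ) := by
  rw [burnolKk, Mk]; ring

/-- **Envelope bounds for `M_k`**: `‖M_k‖ ≤ L^{k+1}` and `‖M_k‖ ≤ 2L^k/|τ-γ|` (`0 < λ < 1`).
[folklore] -/
theorem norm_Mk_le {lam : ℝ} (h0 : 0 < lam) (h1 : lam < 1) (k : ℕ) (γ τ : ℝ) :
    ‖Mk k lam γ τ‖ ≤ Lof lam ^ (k + 1) ∧ (τ ≠ γ → ‖Mk k lam γ τ‖ ≤ 2 * Lof lam ^ k / |τ - γ|) :=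
  norm_model_line_le h0 h1 k γ τ

/-- Measurability of `τ ↦ M_k(λ; γ, τ)`. [folklore] -/
theorem measurable_Mk (k : ℕ) (lam γ : ℝ) : Measurable fun τ : ℝ ↦ Mk k lam γ τ := by
  unfold Mk
  exact measurable_const.mul ((measurable_phiK k).comp (by fun_prop))

/-- **Integral form of `M_k` on the line**: for `τ ≠ γ`, `0 < λ < 1`,
`M_k = (-1)^k ∫_0^L y^k e^{(s-ρ)y} dy`. [folklore] -/
theorem Mk_eq_integral {lam : ℝ} (h0 : 0 < lam) (h1 : lam < 1) (k : ℕ) {γ τ : ℝ} (hτ : τ ≠ γ) :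
    Mk k lam γ τ = (-1) ^ k * ∫ y in (0 : ℝ)..Lof lam,
      (y : ℂ) ^ k * Complex.exp ((((1 / 2 : ℂ) + τ * I) - ((1 / 2 : ℂ) + γ * I)) * y) := by
  have hL := Lof_pos h0 h1
  set u : ℂ := ((1 / 2 : ℂ) + τ * I) - ((1 / 2 : ℂ) + γ * I) with hudef
  have hu : u ≠ 0 := by
    rw [hudef, line_sub_line_eq]
    exact mul_ne_zero (ofReal_ne_zero.2 (sub_ne_zero.2 hτ)) I_ne_zero
  have hz : (Lof lam : ℂ) * u ≠ 0 := mul_ne_zero (by exact_mod_cast hL.ne') hu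
  rw [Mk, phiK_eq_integral hz]
  have hsub := intervalIntegral.smul_integral_comp_mul_left
    (f := fun y : ℝ ↦ (y : ℂ) ^ k * Complex.exp (u * y)) (a := 0) (b := 1) (Lof lam)
  rw [mul_zero, mul_one] at hsub
  rw [← hsub, Complex.real_smul]
  have e : ∫ x in (0 : ℝ)..1, (fun y : ℝ ↦ (y : ℂ) ^ k * Complex.exp (u * y)) (Lof lam * x) =
      (Lof lam : ℂ) ^ k * ∫ x in (0 : ℝ)..1, (x : ℂ) ^ k * Complex.exp ((Lof lam : ℂ) * u * x) := by
    rw [← intervalIntegral.integral_const_mul]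
    refine intervalIntegral.integral_congr fun x _ ↦ ?_
    simp only
    rw [show u * ((Lof lam * x : ℝ) : ℂ) = (Lof lam : ℂ) * u * x by push_cast; ring]
    push_cast
    ring
  rw [e]
  ring

/-! ## 2. The pairing of the model with `r(s)/s`: a bound uniform in `λ` -/

/-- Dividing an `L¹` function on the line by `s` (`‖1/s‖ ≤ 2`) keeps it in `L¹`. [folklore] -/
theorem integrable_div_line {f : ℝ → ℂ} (hf : Integrable f) (hm : Measurable f) :
    Integrable fun τ : ℝ ↦ f τ / ((1 / 2 : ℂ) + τ * I) := by
  refine Integrable.mono' (hf.norm.const_mul 2) (hm.div (by fun_prop)).aestronglyMeasurable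
    (Eventually.of_forall fun τ ↦ ?_)
  rw [norm_div]
  have h := half_le_norm_line τ
  rw [div_le_iff₀ (by linarith)]
  nlinarith [norm_nonneg (f τ)]

/-- `‖r(s)/s‖ ≤ 16 (1+τ²)⁻¹` on the line. [folklore] -/
theorem norm_burnolR_div_line_le (τ : ℝ) :
    ‖burnolR ((1 / 2 : ℂ) + τ * I) / ((1 / 2 : ℂ) + τ * I)‖ ≤ 16 * (1 + τ ^ 2)⁻¹ := by
  rw [norm_div]
  have h1 := norm_burnolR_line_le_inv τ
  have h2 := half_le_norm_line τ
  rw [div_le_iff₀ (by linarith)]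
  calc ‖burnolR ((1 / 2 : ℂ) + τ * I)‖ ≤ 8 * (1 + τ ^ 2)⁻¹ := h1
    _ = 16 * (1 + τ ^ 2)⁻¹ * (1 / 2) := by ring
    _ ≤ 16 * (1 + τ ^ 2)⁻¹ * ‖(1 / 2 : ℂ) + τ * I‖ := by gcongr

/-- `r(s)/s` is continuous and integrable along the line. [folklore] -/
theorem continuous_integrable_burnolR_div_line :
    Continuous (fun τ : ℝ ↦ burnolR ((1 / 2 : ℂ) + τ * I) / ((1 / 2 : ℂ) + τ * I)) ∧
      Integrable (fun τ : ℝ ↦ burnolR ((1 / 2 : ℂ) + τ * I) / ((1 / 2 : ℂ) + τ * I)) := by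
  have hc : Continuous (fun τ : ℝ ↦ burnolR ((1 / 2 : ℂ) + τ * I) / ((1 / 2 : ℂ) + τ * I)) :=
    continuous_burnolR_line.div (by fun_prop) fun τ ↦ line_ne_zero τ
  exact ⟨hc, (integrable_and_memLp_two_of_norm_le hc.measurable norm_burnolR_div_line_le).1⟩

/-- `f(e^{-y}) = p(y)` for `y ≥ 0`. [folklore] -/
theorem fLog_exp_neg {y : ℝ} (hy : 0 ≤ y) : fLog (Real.exp (-y)) = pPolyC y := by
  have h1 : Real.exp (-y) ∈ Ioc (0 : ℝ) 1 := ⟨Real.exp_pos _, by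
    rw [← Real.exp_zero]; exact Real.exp_le_exp.2 (by linarith)⟩
  rw [fLog, indicator_of_mem h1, Real.log_exp, neg_neg]

/-- **The inner integral**: `∫ (r(s)/s) e^{sy} dτ = 2π f(e^{-y})` (Mellin inversion for `f`,
`𝓜f = r(s)/s`, at the point `e^{-y}`). [folklore] -/
theorem integral_burnolR_div_mul_exp (y : ℝ) :
    ∫ τ : ℝ, burnolR ((1 / 2 : ℂ) + τ * I) / ((1 / 2 : ℂ) + τ * I) * Complex.exp (((1 / 2 : ℂ) + τ * I) * y) =
      2 * π * fLog (Real.exp (-y)) := by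
  have h := mellinInv_mellin_fLog (t := Real.exp (-y)) (Real.exp_pos _)
  rw [mellinInv] at h
  have e : ∀ τ : ℝ, ((Real.exp (-y) : ℝ) : ℂ) ^ (-(((1 / 2 : ℝ) : ℂ) + τ * I)) •
      mellin fLog (((1 / 2 : ℝ) : ℂ) + τ * I) =
      burnolR ((1 / 2 : ℂ) + τ * I) / ((1 / 2 : ℂ) + τ * I) * Complex.exp (((1 / 2 : ℂ) + τ * I) * y) := by
    intro τ
    have e1 : (((1 / 2 : ℝ) : ℂ) + τ * I) = (1 / 2 : ℂ) + τ * I := by push_cast; ring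
    rw [e1, ofReal_exp_neg_cpow, mellin_fLog_line, smul_eq_mul]
    rw [show -(y : ℂ) * -((1 / 2 : ℂ) + τ * I) = ((1 / 2 : ℂ) + τ * I) * y by ring]
    ring
  simp_rw [e] at h
  have hπ : (1 / (2 * π) : ℝ) ≠ 0 := by positivity
  have h2 := congrArg (fun z : ℂ ↦ ((2 * π : ℝ) : ℂ) * z) h
  simp only [Complex.real_smul] at h2
  rw [← mul_assoc, ← ofReal_mul, show (2 * π) * (1 / (2 * π)) = (1 : ℝ) by field_simp,
    ofReal_one, one_mul] at h2
  rw [h2]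
  push_cast
  ring

/-- The Laplace-type integrand `x^n e^{-sx}` is integrable on `(0,∞)` for `re s > 0`. [folklore] -/
theorem integrableOn_pow_mul_cexp {s : ℂ} (hs : 0 < s.re) (n : ℕ) :
    IntegrableOn (fun x : ℝ ↦ (x : ℂ) ^ n * Complex.exp (-(s * x))) (Ioi 0) := by
  have hcont : Continuous fun x : ℝ ↦ (x : ℂ) ^ n * Complex.exp (-(s * x)) := by fun_prop
  have hs2 : 0 < (s / 2).re := by simp; linarith
  have ht := tendsto_cexp_neg_mul_pow hs2 n
  rw [tendsto_zero_iff_norm_tendsto_zero] at ht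
  have hev : ∀ᶠ x : ℝ in atTop, ‖‖(x : ℂ) ^ n * Complex.exp (-(s * x))‖‖ ≤
      1 * ‖Real.exp (-(s.re / 2) * x)‖ := by
    filter_upwards [ht.eventually (ge_mem_nhds one_pos), eventually_ge_atTop (0 : ℝ)] with x hx _
    rw [norm_norm, one_mul, Real.norm_eq_abs, abs_of_pos (Real.exp_pos _), norm_mul,
      Complex.norm_exp]
    rw [norm_mul, Complex.norm_exp] at hx
    have e1 : (-(s / 2 * (x : ℂ))).re = -(s.re / 2 * x) := by simp
    have e2 : (-(s * (x : ℂ))).re = -(s.re / 2 * x) + -(s.re / 2 * x) := by simp; ring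
    rw [e1] at hx
    rw [e2, Real.exp_add, ← mul_assoc]
    calc ‖(x : ℂ) ^ n‖ * Real.exp (-(s.re / 2 * x)) * Real.exp (-(s.re / 2 * x))
        ≤ 1 * Real.exp (-(s.re / 2 * x)) := by
          gcongr; rwa [mul_comm] at hx
      _ = Real.exp (-(s.re / 2) * x) := by ring_nf
  have hnorm : IntegrableOn (fun x : ℝ ↦ ‖(x : ℂ) ^ n * Complex.exp (-(s * x))‖) (Ioi 0) :=
    integrable_of_isBigO_exp_neg (b := s.re / 2) (by linarith) hcont.norm.continuousOn
      (IsBigO.of_bound 1 hev)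
  exact (integrable_norm_iff hcont.aestronglyMeasurable).1 hnorm

/-- The `y`-integrand `y^k e^{-ρy} · 2π f(e^{-y})` is integrable on `(0,∞)` (`re ρ > 0`). [folklore] -/
theorem integrableOn_pow_mul_exp_mul_fLog {ρ : ℂ} (hρ : 0 < ρ.re) (k : ℕ) :
    IntegrableOn (fun y : ℝ ↦ (y : ℂ) ^ k * Complex.exp (-(ρ * y)) * (2 * π * fLog (Real.exp (-y))))
      (Ioi 0) := by
  have h3 := integrableOn_pow_mul_cexp hρ (k + 3)
  have h4 := integrableOn_pow_mul_cexp hρ (k + 4)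
  refine IntegrableOn.congr_fun ((h3.const_mul (2 * π / 6 : ℂ)).sub (h4.const_mul (2 * π / 24 : ℂ)))
    (fun y hy ↦ ?_) measurableSet_Ioi
  have hy0 : 0 ≤ y := le_of_lt hy
  simp only [Pi.sub_apply]
  rw [fLog_exp_neg hy0, pPolyC]
  ring

/-- **The model pairing through Fubini**: for `0 < λ < 1`,
`∫ (r(s)/s) M_k dτ = (-1)^k ∫_0^L y^k e^{-ρy} · 2π f(e^{-y}) dy`. [folklore] -/
theorem integral_burnolR_div_mul_Mk_eq {lam : ℝ} (h0 : 0 < lam) (h1 : lam < 1) (k : ℕ) (γ : ℝ) :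
    ∫ τ : ℝ, burnolR ((1 / 2 : ℂ) + τ * I) / ((1 / 2 : ℂ) + τ * I) * Mk k lam γ τ =
      (-1) ^ k * ∫ y in Ioc (0 : ℝ) (Lof lam), (y : ℂ) ^ k *
        Complex.exp (-(((1 / 2 : ℂ) + γ * I) * y)) * (2 * π * fLog (Real.exp (-y))) := by
  have hL := Lof_pos h0 h1
  set ρ : ℂ := (1 / 2 : ℂ) + γ * I with hρdef
  set F : ℝ → ℂ := fun τ ↦ burnolR ((1 / 2 : ℂ) + τ * I) / ((1 / 2 : ℂ) + τ * I) with hFdef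
  obtain ⟨hFc, hFi⟩ := continuous_integrable_burnolR_div_line
  set g : ℝ → ℝ → ℂ := fun τ y ↦ (y : ℂ) ^ k * Complex.exp ((((1 / 2 : ℂ) + τ * I) - ρ) * y) with hgdef
  set ν : Measure ℝ := volume.restrict (Ioc (0 : ℝ) (Lof lam)) with hνdef
  haveI : IsFiniteMeasure ν := by
    rw [hνdef]; exact isFiniteMeasure_restrict.2 measure_Ioc_lt_top.ne
  -- Step 1: the integrand is a.e. `(-1)^k F(τ) ∫_ν g(τ, y)`
  have hae : ∀ᵐ τ : ℝ, F τ * Mk k lam γ τ = (-1) ^ k * ∫ y, F τ * g τ y ∂ν := by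
    filter_upwards [ae_ne γ] with τ hτ
    rw [Mk_eq_integral h0 h1 k hτ, intervalIntegral.integral_of_le hL.le, ← hνdef,
      ← integral_const_mul]
    rw [← integral_const_mul, ← integral_const_mul]
    refine integral_congr_ae (Eventually.of_forall fun y ↦ ?_)
    simp only [hgdef]
    ring
  rw [integral_congr_ae hae, integral_const_mul]
  congr 1
  -- Step 2: Fubini
  have hint : Integrable (Function.uncurry fun τ y ↦ F τ * g τ y) ((volume : Measure ℝ).prod ν) := by
    have hmeas : AEStronglyMeasurable (Function.uncurry fun τ y ↦ F τ * g τ y)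
        ((volume : Measure ℝ).prod ν) := by
      refine Continuous.aestronglyMeasurable ?_
      exact (hFc.comp continuous_fst).mul (by simp only [hgdef]; fun_prop)
    have hdom : Integrable (fun p : ℝ × ℝ ↦ ‖F p.1‖ * (Lof lam ^ k : ℝ)) ((volume : Measure ℝ).prod ν) :=
      hFi.norm.mul_prod (integrable_const _)
    refine hdom.mono' hmeas ?_
    have hae2 : ∀ᵐ p : ℝ × ℝ ∂((volume : Measure ℝ).prod ν), p.2 ∈ Ioc (0 : ℝ) (Lof lam) :=
      (Measure.quasiMeasurePreserving_snd (μ := (volume : Measure ℝ)) (ν := ν)).ae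
        (ae_restrict_mem measurableSet_Ioc)
    filter_upwards [hae2] with p hp
    simp only [Function.uncurry, hgdef, norm_mul, norm_pow, Complex.norm_real, Real.norm_eq_abs,
      abs_of_pos hp.1]
    rw [show (((1 / 2 : ℂ) + (p.1 : ℂ) * I) - ρ) * (p.2 : ℂ) = (((p.1 - γ) * p.2 : ℝ) : ℂ) * I by
      rw [hρdef]; push_cast; ring, norm_exp_ofReal_mul_I, mul_one]
    exact mul_le_mul_of_nonneg_left (pow_le_pow_left₀ hp.1.le hp.2 k) (norm_nonneg _)
  rw [integral_integral_swap hint]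
  -- Step 3: the inner integral
  refine setIntegral_congr_fun measurableSet_Ioc fun y hy ↦ ?_
  have e : ∀ τ : ℝ, F τ * g τ y = ((y : ℂ) ^ k * Complex.exp (-(ρ * y))) *
      (F τ * Complex.exp (((1 / 2 : ℂ) + τ * I) * y)) := by
    intro τ
    simp only [hgdef]
    rw [sub_mul, Complex.exp_sub, div_eq_mul_inv, ← Complex.exp_neg]
    ring
  simp_rw [e]
  rw [integral_const_mul, integral_burnolR_div_mul_exp]

/-- **Uniform bound for the model pairing**: `‖∫ (r(s)/s) M_k dτ‖ ≤ C_k` for all `0 < λ < 1`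
(`C_k = ∫_0^∞ y^k e^{-y/2} 2π|p(y)| dy`; Burnol: "(χ₁, Y^λ_{ρ,k}) admit finite limits").
[cite: Burnol2002, Thm. 5.3 (proof)] -/
theorem norm_integral_burnolR_div_mul_Mk_le (k : ℕ) (γ : ℝ) :
    ∃ C : ℝ, ∀ lam : ℝ, 0 < lam → lam < 1 →
      ‖∫ τ : ℝ, burnolR ((1 / 2 : ℂ) + τ * I) / ((1 / 2 : ℂ) + τ * I) * Mk k lam γ τ‖ ≤ C := by
  set ρ : ℂ := (1 / 2 : ℂ) + γ * I with hρdef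
  set h : ℝ → ℂ := fun y ↦ (y : ℂ) ^ k * Complex.exp (-(ρ * y)) * (2 * π * fLog (Real.exp (-y)))
    with hhdef
  have hint : IntegrableOn h (Ioi 0) := integrableOn_pow_mul_exp_mul_fLog (by simp [hρdef]) k
  refine ⟨∫ y in Ioi (0 : ℝ), ‖h y‖, fun lam h0 h1 ↦ ?_⟩
  rw [integral_burnolR_div_mul_Mk_eq h0 h1 k γ, norm_mul, norm_pow, norm_neg, norm_one, one_pow,
    one_mul]
  calc ‖∫ y in Ioc (0 : ℝ) (Lof lam), h y‖ ≤ ∫ y in Ioc (0 : ℝ) (Lof lam), ‖h y‖ :=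
      norm_integral_le_integral_norm _
    _ ≤ ∫ y in Ioi (0 : ℝ), ‖h y‖ :=
      setIntegral_mono_set hint.norm (Eventually.of_forall fun y ↦ norm_nonneg _)
        (Eventually.of_forall Ioc_subset_Ioi_self : (Ioc (0 : ℝ) (Lof lam) : Set ℝ) ≤ᵐ[volume] Ioi 0)

/-! ## 3. The pairing `∫ K_k(s)/s dτ` is `o(L^k)` for `k ≥ 1` -/

/-- **The recurrence on the line**: `(s-ρ) M_{k+1} = (k+1) M_k + (-L)^{k+1} e^{L(s-ρ)}`
(`τ ≠ γ`, `0 < λ < 1`; one integration by parts of `∫_0^L y^{k+1} e^{(s-ρ)y} dy`). [folklore] -/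
theorem sub_mul_Mk_succ {lam : ℝ} (h0 : 0 < lam) (h1 : lam < 1) (k : ℕ) {γ τ : ℝ} (hτ : τ ≠ γ) :
    (((1 / 2 : ℂ) + τ * I) - ((1 / 2 : ℂ) + γ * I)) * Mk (k + 1) lam γ τ =
      ((k : ℂ) + 1) * Mk k lam γ τ + (-(Lof lam : ℂ)) ^ (k + 1) *
        Complex.exp ((Lof lam : ℂ) * (((1 / 2 : ℂ) + τ * I) - ((1 / 2 : ℂ) + γ * I))) := by
  have hL := Lof_pos h0 h1
  set u : ℂ := ((1 / 2 : ℂ) + τ * I) - ((1 / 2 : ℂ) + γ * I) with hudef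
  have hu : u ≠ 0 := by
    rw [hudef, line_sub_line_eq]
    exact mul_ne_zero (ofReal_ne_zero.2 (sub_ne_zero.2 hτ)) I_ne_zero
  have hz : (Lof lam : ℂ) * u ≠ 0 := mul_ne_zero (by exact_mod_cast hL.ne') hu
  have hrec := mul_phiK_succ hz k
  simp only [Mk]
  have e : u * ((Lof lam : ℂ) ^ (k + 1 + 1) * phiK (k + 1) ((Lof lam : ℂ) * u)) =
      (Lof lam : ℂ) ^ (k + 1) * (((Lof lam : ℂ) * u) * phiK (k + 1) ((Lof lam : ℂ) * u)) := by ring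
  rw [e, hrec]
  ring

/-- `((L)^{k+1})⁻¹ → 0` as `λ → 0⁺` (complex form). [folklore] -/
theorem tendsto_inv_Lof_pow_succ (k : ℕ) :
    Tendsto (fun lam : ℝ ↦ ((Lof lam : ℂ) ^ (k + 1))⁻¹) (𝓝[>] 0) (𝓝 0) := by
  have h := tendsto_inv_Lof.pow (k + 1)
  rw [zero_pow (Nat.succ_ne_zero k)] at h
  have h2 := (Complex.continuous_ofReal.tendsto 0).comp h
  rw [ofReal_zero] at h2
  refine h2.congr fun lam ↦ ?_
  simp [Function.comp]

/-- The bound `‖(V(s)/V(ρ) - 1)/(s-ρ)‖ ≤ D` on the whole line (junk `0` at `τ = γ`). [folklore] -/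
theorem norm_Wtilde_le {γ D : ℝ}
    (hD : ∀ τ : ℝ, ‖burnolV ((1 / 2 : ℂ) + τ * I) / burnolV ((1 / 2 : ℂ) + γ * I) - 1‖ ≤ D * |τ - γ|)
    (τ : ℝ) :
    ‖(Wf ((1 / 2 : ℂ) + γ * I) ((1 / 2 : ℂ) + τ * I) - 1) /
        (((1 / 2 : ℂ) + τ * I) - ((1 / 2 : ℂ) + γ * I))‖ ≤ D := by
  have hD0 : 0 ≤ D := by
    have := hD (γ + 1)
    rw [add_sub_cancel_left, abs_one, mul_one] at this
    exact (norm_nonneg _).trans this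
  by_cases hτ : τ = γ
  · subst hτ; simp; exact hD0
  rw [norm_div, norm_line_sub_line, Wf, div_le_iff₀ (abs_pos.2 (sub_ne_zero.2 hτ))]
  exact hD τ

/-- **The pairing of the `(k+1)`-st vector with `χ` is `o(L^{k+1})`** (Burnol, Thm. 5.3:
"`lim √(log(1/λ)) (χ₁, X^λ_{ρ,k}) = 0 (k ≥ 1)`", here on the Mellin side for the data `K_{k+1}`):
`L^{-(k+1)} ∫ K_{k+1}(s)/s dτ → 0` as `λ → 0⁺`. Proof: `K_{k+1}/s = -(k+1)!(r/s)Z_{k+1} - (r/s)M_{k+1}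
- (k+1)(r/s)W̃ M_k - (-L)^{k+1} k₂/s` (recurrence), the four pieces being respectively constant,
bounded (`norm_integral_burnolR_div_mul_Mk_le`), `o(L^{k+1})` by dominated convergence, and
`L^{k+1}·o(1)` by Riemann–Lebesgue (`tendsto_integral_burnolK2_div`). [cite: Burnol2002, Thm. 5.3] -/
theorem tendsto_integral_burnolKk_succ_div (γ : ℝ) (k : ℕ) :
    Tendsto (fun lam : ℝ ↦ ((Lof lam : ℂ) ^ (k + 1))⁻¹ *
      ∫ τ : ℝ, burnolKk ((1 / 2 : ℂ) + γ * I) (k + 1) lam ((1 / 2 : ℂ) + τ * I) / ((1 / 2 : ℂ) + τ * I))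
      (𝓝[>] 0) (𝓝 0) := by
  set ρ : ℂ := (1 / 2 : ℂ) + γ * I with hρdef
  obtain ⟨D, hD0, hD⟩ := exists_norm_Zk_line_le γ (k + 1)
  obtain ⟨DW, hDW0, hDW⟩ := exists_norm_burnolV_div_sub_one_le γ
  obtain ⟨C, hC⟩ := norm_integral_burnolR_div_mul_Mk_le (k + 1) γ
  obtain ⟨hFc, hFi⟩ := continuous_integrable_burnolR_div_line
  set F : ℝ → ℂ := fun τ ↦ burnolR ((1 / 2 : ℂ) + τ * I) / ((1 / 2 : ℂ) + τ * I) with hFdef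
  set Wt : ℝ → ℂ := fun τ ↦ (Wf ρ ((1 / 2 : ℂ) + τ * I) - 1) / (((1 / 2 : ℂ) + τ * I) - ρ) with hWtdef
  have hWt : ∀ τ, ‖Wt τ‖ ≤ DW := norm_Wtilde_le hDW
  have hWtm : Measurable Wt := by
    simp only [hWtdef]
    exact ((continuous_Wf_line ρ).measurable.sub measurable_const).div (by fun_prop)
  have hFn : ∀ τ, ‖F τ‖ ≤ 16 * (1 + τ ^ 2)⁻¹ := norm_burnolR_div_line_le
  -- the four terms
  set T1 : ℝ → ℂ := fun τ ↦ -(((k + 1)! : ℕ) : ℂ) * (F τ * Zk ρ (k + 1) ((1 / 2 : ℂ) + τ * I)) with hT1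
  set T2 : ℝ → ℝ → ℂ := fun lam τ ↦ -(F τ * Mk (k + 1) lam γ τ) with hT2
  set T3 : ℝ → ℝ → ℂ := fun lam τ ↦ -((k : ℂ) + 1) * (F τ * Wt τ * Mk k lam γ τ) with hT3
  set T4 : ℝ → ℝ → ℂ := fun lam τ ↦ -(-(Lof lam : ℂ)) ^ (k + 1) *
    (burnolK2 ρ lam ((1 / 2 : ℂ) + τ * I) / ((1 / 2 : ℂ) + τ * I)) with hT4
  ------------------------------------------------------------------
  -- the pointwise decomposition (off `τ = γ`)
  ------------------------------------------------------------------
  have hdec : ∀ {lam : ℝ}, 0 < lam → lam < 1 → ∀ {τ : ℝ}, τ ≠ γ →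
      burnolKk ρ (k + 1) lam ((1 / 2 : ℂ) + τ * I) / ((1 / 2 : ℂ) + τ * I) =
        T1 τ + T2 lam τ + T3 lam τ + T4 lam τ := by
    intro lam h0 h1 τ hτ
    have hu : ((1 / 2 : ℂ) + τ * I) - ρ ≠ 0 := by
      rw [hρdef, line_sub_line_eq]
      exact mul_ne_zero (ofReal_ne_zero.2 (sub_ne_zero.2 hτ)) I_ne_zero
    have hrec := sub_mul_Mk_succ h0 h1 k hτ
    rw [← hρdef] at hrec
    set E : ℂ := Complex.exp ((Lof lam : ℂ) * (((1 / 2 : ℂ) + τ * I) - ρ)) with hE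
    have hM0 : ((k : ℂ) + 1) * Mk k lam γ τ =
        (((1 / 2 : ℂ) + τ * I) - ρ) * Mk (k + 1) lam γ τ - (-(Lof lam : ℂ)) ^ (k + 1) * E := by
      rw [hrec]; ring
    have hWu : Wt τ * (((1 / 2 : ℂ) + τ * I) - ρ) = Wf ρ ((1 / 2 : ℂ) + τ * I) - 1 := by
      simp only [hWtdef]; exact div_mul_cancel₀ _ hu
    -- `T3 + T4 = -(r/s)(W - 1) M_{k+1}`
    have h3 : T3 lam τ = -(F τ * Wt τ *
        ((((1 / 2 : ℂ) + τ * I) - ρ) * Mk (k + 1) lam γ τ - (-(Lof lam : ℂ)) ^ (k + 1) * E)) := by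
      simp only [hT3]; rw [← hM0]; ring
    have h4 : T4 lam τ = -((-(Lof lam : ℂ)) ^ (k + 1) * (F τ * Wt τ * E)) := by
      simp only [hT4, hWtdef, hFdef, hE]
      rw [burnolK2, cpow_rho_sub_eq_exp h0, Wf]
      ring
    have hA : T3 lam τ + T4 lam τ =
        -(F τ * (Wf ρ ((1 / 2 : ℂ) + τ * I) - 1) * Mk (k + 1) lam γ τ) := by
      rw [h3, h4]
      linear_combination (-(F τ * Mk (k + 1) lam γ τ)) * hWu
    calc burnolKk ρ (k + 1) lam ((1 / 2 : ℂ) + τ * I) / ((1 / 2 : ℂ) + τ * I)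
        = T1 τ + T2 lam τ + -(F τ * (Wf ρ ((1 / 2 : ℂ) + τ * I) - 1) * Mk (k + 1) lam γ τ) := by
          simp only [hT1, hT2, hFdef]
          rw [burnolKk_line_eq]
          ring
      _ = T1 τ + T2 lam τ + T3 lam τ + T4 lam τ := by rw [add_assoc _ (T3 lam τ), hA]
  ------------------------------------------------------------------
  -- integrability of the four terms (for `0 < λ < 1`)
  ------------------------------------------------------------------
  have hI1 : Integrable T1 := by
    refine Integrable.mono' ((hFi.norm.mul_const D).const_mul ((k + 1)! : ℝ)) ?_ ?_
    · exact ((hFc.measurable.mul (continuous_Zk_line γ (k + 1)).measurable).const_mul _).aestronglyMeasurable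
    · refine Eventually.of_forall fun τ ↦ ?_
      simp only [hT1, norm_mul, norm_neg, Complex.norm_natCast]
      gcongr
      exact hD τ
  have hI2 : ∀ {lam : ℝ}, 0 < lam → lam < 1 → Integrable (T2 lam) := by
    intro lam h0 h1
    refine Integrable.mono' (hFi.norm.mul_const (Lof lam ^ (k + 1 + 1))) ?_ ?_
    · exact (hFc.measurable.mul (measurable_Mk (k + 1) lam γ)).neg.aestronglyMeasurable
    · refine Eventually.of_forall fun τ ↦ ?_
      simp only [hT2, norm_neg, norm_mul]
      gcongr
      exact (norm_Mk_le h0 h1 (k + 1) γ τ).1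
  have hI3 : ∀ {lam : ℝ}, 0 < lam → lam < 1 → Integrable (T3 lam) := by
    intro lam h0 h1
    refine Integrable.mono' ((hFi.norm.mul_const (DW * Lof lam ^ (k + 1))).const_mul ((k : ℝ) + 1)) ?_ ?_
    · exact (((hFc.measurable.mul hWtm).mul (measurable_Mk k lam γ)).const_mul _).aestronglyMeasurable
    · refine Eventually.of_forall fun τ ↦ ?_
      simp only [hT3, norm_mul, norm_neg]
      rw [show ‖((k : ℂ) + 1)‖ = (k : ℝ) + 1 by
        rw [show ((k : ℂ) + 1) = ((k + 1 : ℕ) : ℂ) by push_cast; ring, Complex.norm_natCast]; push_cast; ring]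
      rw [mul_assoc (‖F τ‖)]
      exact mul_le_mul_of_nonneg_left (mul_le_mul_of_nonneg_left
        (mul_le_mul (hWt τ) (norm_Mk_le h0 h1 k γ τ).1 (norm_nonneg _) hDW0.le) (norm_nonneg _))
        (by positivity)
  have hI4 : ∀ {lam : ℝ}, 0 < lam → lam < 1 → Integrable (T4 lam) := by
    intro lam h0 _
    exact (integrable_div_line (integrable_burnolK2_line h0 γ).1 (measurable_burnolK2_line γ lam)).const_mul _
  ------------------------------------------------------------------
  -- the four limits
  ------------------------------------------------------------------
  have hLinv := tendsto_inv_Lof_pow_succ k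
  -- (1) the constant term
  have hL1 : Tendsto (fun lam : ℝ ↦ ((Lof lam : ℂ) ^ (k + 1))⁻¹ * ∫ τ, T1 τ) (𝓝[>] 0) (𝓝 0) := by
    have h := hLinv.mul_const (∫ τ, T1 τ)
    rw [zero_mul] at h
    exact h
  -- (2) the bounded term
  have hL2 : Tendsto (fun lam : ℝ ↦ ((Lof lam : ℂ) ^ (k + 1))⁻¹ * ∫ τ, T2 lam τ) (𝓝[>] 0) (𝓝 0) := by
    have hb : Tendsto (fun lam : ℝ ↦ ‖((Lof lam : ℂ) ^ (k + 1))⁻¹‖ * C) (𝓝[>] 0) (𝓝 0) := by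
      have h := hLinv.norm.mul_const C
      rw [norm_zero, zero_mul] at h
      exact h
    refine squeeze_zero_norm' ?_ hb
    filter_upwards [eventually_mem_Ioo] with lam hlam
    rw [norm_mul]
    gcongr
    simp only [hT2]
    rw [integral_neg, norm_neg]
    exact hC lam hlam.1 hlam.2
  -- (3) dominated convergence
  have hL3 : Tendsto (fun lam : ℝ ↦ ((Lof lam : ℂ) ^ (k + 1))⁻¹ * ∫ τ, T3 lam τ) (𝓝[>] 0) (𝓝 0) := by
    simp_rw [← integral_const_mul]
    have key := tendsto_integral_filter_of_dominated_convergence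
      (F := fun (lam τ : ℝ) ↦ ((Lof lam : ℂ) ^ (k + 1))⁻¹ * T3 lam τ)
      (f := fun _ ↦ (0 : ℂ)) (l := 𝓝[>] (0 : ℝ)) (μ := volume)
      (fun τ ↦ ((k : ℝ) + 1) * DW * (16 * (1 + τ ^ 2)⁻¹)) ?_ ?_ ?_ ?_
    · rw [integral_zero] at key; exact key
    · refine Eventually.of_forall fun lam ↦ ?_
      exact ((((hFc.measurable.mul hWtm).mul (measurable_Mk k lam γ)).const_mul _).const_mul _).aestronglyMeasurable
    · filter_upwards [eventually_mem_Ioo] with lam hlam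
      refine Eventually.of_forall fun τ ↦ ?_
      have hL := Lof_pos hlam.1 hlam.2
      have hLn : ‖((Lof lam : ℂ) ^ (k + 1))⁻¹‖ = (Lof lam ^ (k + 1))⁻¹ := by
        rw [norm_inv, norm_pow, norm_real, Real.norm_of_nonneg hL.le]
      simp only [hT3, norm_mul, norm_neg, hLn]
      rw [show ‖((k : ℂ) + 1)‖ = (k : ℝ) + 1 by
        rw [show ((k : ℂ) + 1) = ((k + 1 : ℕ) : ℂ) by push_cast; ring, Complex.norm_natCast]; push_cast; ring]
      have hM := (norm_Mk_le hlam.1 hlam.2 k γ τ).1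
      calc (Lof lam ^ (k + 1))⁻¹ * (((k : ℝ) + 1) * (‖F τ‖ * ‖Wt τ‖ * ‖Mk k lam γ τ‖))
          ≤ (Lof lam ^ (k + 1))⁻¹ * (((k : ℝ) + 1) * ((16 * (1 + τ ^ 2)⁻¹) * DW * Lof lam ^ (k + 1))) := by
            gcongr
            · exact hFn τ
            · exact hWt τ
        _ = ((k : ℝ) + 1) * DW * (16 * (1 + τ ^ 2)⁻¹) := by field_simp
    · exact (integrable_inv_one_add_sq.const_mul _).const_mul _
    · filter_upwards [ae_ne γ] with τ hτ
      have hv : 0 < |τ - γ| := abs_pos.2 (sub_ne_zero.2 hτ)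
      have hup : Tendsto (fun lam : ℝ ↦ (Lof lam)⁻¹ * (((k : ℝ) + 1) * (16 * DW * (2 / |τ - γ|))))
          (𝓝[>] 0) (𝓝 0) := by
        simpa using tendsto_inv_Lof.mul_const (((k : ℝ) + 1) * (16 * DW * (2 / |τ - γ|)))
      refine squeeze_zero_norm' ?_ hup
      filter_upwards [eventually_mem_Ioo] with lam hlam
      have hL := Lof_pos hlam.1 hlam.2
      have hLn : ‖((Lof lam : ℂ) ^ (k + 1))⁻¹‖ = (Lof lam ^ (k + 1))⁻¹ := by
        rw [norm_inv, norm_pow, norm_real, Real.norm_of_nonneg hL.le]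
      simp only [hT3, norm_mul, norm_neg, hLn]
      rw [show ‖((k : ℂ) + 1)‖ = (k : ℝ) + 1 by
        rw [show ((k : ℂ) + 1) = ((k + 1 : ℕ) : ℂ) by push_cast; ring, Complex.norm_natCast]; push_cast; ring]
      have hM := (norm_Mk_le hlam.1 hlam.2 k γ τ).2 hτ
      have hF16 : ‖F τ‖ ≤ 16 := by
        refine (hFn τ).trans ?_
        have : (1 + τ ^ 2)⁻¹ ≤ 1 := inv_le_one_of_one_le₀ (by nlinarith)
        nlinarith
      have hprod : ‖F τ‖ * ‖Wt τ‖ * ‖Mk k lam γ τ‖ ≤ 16 * DW * (2 * Lof lam ^ k / |τ - γ|) :=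
        mul_le_mul (mul_le_mul hF16 (hWt τ) (norm_nonneg _) (by norm_num)) hM (norm_nonneg _)
          (by positivity)
      calc (Lof lam ^ (k + 1))⁻¹ * (((k : ℝ) + 1) * (‖F τ‖ * ‖Wt τ‖ * ‖Mk k lam γ τ‖))
          ≤ (Lof lam ^ (k + 1))⁻¹ * (((k : ℝ) + 1) * (16 * DW * (2 * Lof lam ^ k / |τ - γ|))) :=
            mul_le_mul_of_nonneg_left (mul_le_mul_of_nonneg_left hprod (by positivity)) (by positivity)
        _ = (Lof lam)⁻¹ * (((k : ℝ) + 1) * (16 * DW * (2 / |τ - γ|))) := by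
            field_simp
            ring
  -- (4) Riemann–Lebesgue
  have hL4 : Tendsto (fun lam : ℝ ↦ ((Lof lam : ℂ) ^ (k + 1))⁻¹ * ∫ τ, T4 lam τ) (𝓝[>] 0) (𝓝 0) := by
    have h := (tendsto_integral_burnolK2_div γ).const_mul (-(-1 : ℂ) ^ (k + 1))
    rw [mul_zero] at h
    refine h.congr' ?_
    filter_upwards [eventually_mem_Ioo] with lam hlam
    have hL : (Lof lam : ℂ) ≠ 0 := by exact_mod_cast (Lof_pos hlam.1 hlam.2).ne'
    simp only [hT4]
    rw [integral_const_mul, ← mul_assoc]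
    congr 1
    rw [neg_pow (Lof lam : ℂ)]
    field_simp
  ------------------------------------------------------------------
  -- conclusion
  ------------------------------------------------------------------
  have hsum := ((hL1.add hL2).add hL3).add hL4
  rw [add_zero, add_zero, add_zero] at hsum
  refine hsum.congr' ?_
  filter_upwards [eventually_mem_Ioo] with lam hlam
  have eK : ∫ τ : ℝ, burnolKk ρ (k + 1) lam ((1 / 2 : ℂ) + τ * I) / ((1 / 2 : ℂ) + τ * I) =
      ∫ τ : ℝ, (T1 τ + T2 lam τ + T3 lam τ + T4 lam τ) := by
    refine integral_congr_ae ?_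
    filter_upwards [ae_ne γ] with τ hτ
    exact hdec hlam.1 hlam.2 hτ
  have eA : ∫ τ : ℝ, (T1 τ + T2 lam τ) = (∫ τ : ℝ, T1 τ) + ∫ τ : ℝ, T2 lam τ :=
    integral_add hI1 (hI2 hlam.1 hlam.2)
  have eB : ∫ τ : ℝ, (T1 τ + T2 lam τ + T3 lam τ) = (∫ τ : ℝ, (T1 τ + T2 lam τ)) + ∫ τ : ℝ, T3 lam τ :=
    integral_add (hI1.add (hI2 hlam.1 hlam.2)) (hI3 hlam.1 hlam.2)
  have eC : ∫ τ : ℝ, (T1 τ + T2 lam τ + T3 lam τ + T4 lam τ) =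
      (∫ τ : ℝ, (T1 τ + T2 lam τ + T3 lam τ)) + ∫ τ : ℝ, T4 lam τ :=
    integral_add ((hI1.add (hI2 hlam.1 hlam.2)).add (hI3 hlam.1 hlam.2)) (hI4 hlam.1 hlam.2)
  rw [eK, eC, eB, eA]
  ring

/-! ## 4. Parseval for `L¹ ∩ L²` pairs and the Gram constants of the model -/

open scoped FourierTransform

section Parseval

/-- Pointwise: `‖u + c v‖² = ‖u‖² + ‖c‖² ‖v‖² + 2 re(c · ū v)`. [folklore] -/
lemma norm_sq_add_mul (u v c : ℂ) :
    ‖u + c * v‖ ^ 2 = ‖u‖ ^ 2 + ‖c‖ ^ 2 * ‖v‖ ^ 2 + 2 * (c * (conj u * v)).re := by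
  have h1 : ‖u + c * v‖ ^ 2 = ‖u‖ ^ 2 + ‖c * v‖ ^ 2 + 2 * (u * conj (c * v)).re := by
    rw [Complex.sq_norm, Complex.sq_norm, Complex.sq_norm]; exact Complex.normSq_add u (c * v)
  have h2 : ‖c * v‖ ^ 2 = ‖c‖ ^ 2 * ‖v‖ ^ 2 := by rw [norm_mul, mul_pow]
  have h3 : (u * conj (c * v)).re = (c * (conj u * v)).re := by
    rw [show u * conj (c * v) = conj (c * (conj u * v)) by
      simp only [map_mul, Complex.conj_conj]; ring, Complex.conj_re]
  rw [h1, h2, h3]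

/-- Integrated: `∫ ‖u + c v‖² = ∫ ‖u‖² + ‖c‖² ∫ ‖v‖² + 2 re(c ∫ ū v)` for `L²` functions (any
measure). [folklore] -/
lemma integral_norm_sq_add_mul {α : Type*} [MeasurableSpace α] {μ : Measure α} {u v : α → ℂ}
    (hu : MemLp u 2 μ) (hv : MemLp v 2 μ) (c : ℂ) :
    ∫ x, ‖u x + c * v x‖ ^ 2 ∂μ =
      (∫ x, ‖u x‖ ^ 2 ∂μ) + ‖c‖ ^ 2 * (∫ x, ‖v x‖ ^ 2 ∂μ) + 2 * (c * ∫ x, conj (u x) * v x ∂μ).re := by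
  have hu2 : Integrable (fun x ↦ ‖u x‖ ^ 2) μ := (memLp_two_iff_integrable_sq_norm hu.1).1 hu
  have hv2 : Integrable (fun x ↦ ‖v x‖ ^ 2) μ := (memLp_two_iff_integrable_sq_norm hv.1).1 hv
  have hcu : MemLp (fun x ↦ conj (u x)) 2 μ := by
    refine (memLp_two_iff_integrable_sq_norm
      (continuous_conj.comp_aestronglyMeasurable hu.1)).2 ?_
    exact hu2.congr (Eventually.of_forall fun x ↦ by simp)
  have huv : Integrable (fun x ↦ conj (u x) * v x) μ := hcu.integrable_mul hv
  simp_rw [norm_sq_add_mul]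
  have e1 : ∫ x, (‖u x‖ ^ 2 + ‖c‖ ^ 2 * ‖v x‖ ^ 2 + 2 * (c * (conj (u x) * v x)).re) ∂μ =
      (∫ x, (‖u x‖ ^ 2 + ‖c‖ ^ 2 * ‖v x‖ ^ 2) ∂μ) + ∫ x, 2 * (c * (conj (u x) * v x)).re ∂μ :=
    integral_add (hu2.add (hv2.const_mul _)) ((huv.const_mul c).re.const_mul 2)
  have e2 : ∫ x, (‖u x‖ ^ 2 + ‖c‖ ^ 2 * ‖v x‖ ^ 2) ∂μ =
      (∫ x, ‖u x‖ ^ 2 ∂μ) + ∫ x, ‖c‖ ^ 2 * ‖v x‖ ^ 2 ∂μ := integral_add hu2 (hv2.const_mul _)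
  have e3 : ∫ x, (c * (conj (u x) * v x)).re ∂μ = (∫ x, c * (conj (u x) * v x) ∂μ).re := by
    have := integral_re (huv.const_mul c)
    simpa using this
  rw [e1, e2, integral_const_mul, integral_const_mul, e3, integral_const_mul]

/-- **Polarisation**: if two `L²` pairs `(u,v)` and `(U,V)` (possibly for different measures) have
`∫ ‖U + cV‖² = K ∫ ‖u + cv‖²` for `c = 0`… precisely `∫‖U‖² = K∫‖u‖²`, `∫‖V‖² = K∫‖v‖²` and
`∫‖U + cV‖² = K ∫‖u + cv‖²` for `c = 1, -i`, then `∫ conj(U) V = K ∫ conj(u) v`. [folklore] -/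
lemma integral_conj_mul_eq_of_norm_sq {α β : Type*} [MeasurableSpace α] [MeasurableSpace β]
    {μ : Measure α} {ν : Measure β} {u v : α → ℂ} {U V : β → ℂ} {K : ℝ}
    (hu : MemLp u 2 μ) (hv : MemLp v 2 μ) (hU : MemLp U 2 ν) (hV : MemLp V 2 ν)
    (h0 : ∫ x, ‖U x‖ ^ 2 ∂ν = K * ∫ x, ‖u x‖ ^ 2 ∂μ) (h0' : ∫ x, ‖V x‖ ^ 2 ∂ν = K * ∫ x, ‖v x‖ ^ 2 ∂μ)
    (h : ∀ c : ℂ, (c = 1 ∨ c = -I) →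
      ∫ x, ‖U x + c * V x‖ ^ 2 ∂ν = K * ∫ x, ‖u x + c * v x‖ ^ 2 ∂μ) :
    ∫ x, conj (U x) * V x ∂ν = (K : ℂ) * ∫ x, conj (u x) * v x ∂μ := by
  have key : ∀ c : ℂ, (c = 1 ∨ c = -I) →
      (c * ∫ x, conj (U x) * V x ∂ν).re = (c * ((K : ℂ) * ∫ x, conj (u x) * v x ∂μ)).re := by
    intro c hc
    have hP := h c hc
    rw [integral_norm_sq_add_mul hU hV c, integral_norm_sq_add_mul hu hv c, h0, h0'] at hP
    have hc1 : ‖c‖ ^ 2 = 1 := by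
      rcases hc with rfl | rfl <;> simp
    rw [hc1] at hP
    have e : (c * ((K : ℂ) * ∫ x, conj (u x) * v x ∂μ)).re = K * (c * ∫ x, conj (u x) * v x ∂μ).re := by
      rw [show c * ((K : ℂ) * ∫ x, conj (u x) * v x ∂μ) = (K : ℂ) * (c * ∫ x, conj (u x) * v x ∂μ) by ring,
        Complex.re_ofReal_mul]
    rw [e]
    linarith
  apply Complex.ext
  · simpa using key 1 (Or.inl rfl)
  · have h2 := key (-I) (Or.inr rfl)
    simp only [neg_mul, Complex.neg_re, Complex.I_mul_re, neg_neg] at h2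
    exact h2

/-- The exponential kernel keeps `L¹` functions in `L¹`. [folklore] -/
lemma integrable_exp_mul {f : ℝ → ℂ} (hf : Integrable f) (w : ℝ) :
    Integrable fun v : ℝ ↦ Complex.exp (((-2 * π * v * w : ℝ) : ℂ) * I) • f v := by
  refine hf.norm.mono' ?_ (Eventually.of_forall fun v ↦ ?_)
  · exact ((by fun_prop : Continuous fun v : ℝ ↦ Complex.exp (((-2 * π * v * w : ℝ) : ℂ) * I)).aestronglyMeasurable.smul hf.1)
  · rw [norm_smul, norm_exp_ofReal_mul_I, one_mul]

/-- Linearity of the Fourier integral on `L¹`: `𝓕(f + c g) = 𝓕 f + c 𝓕 g`. [folklore] -/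
lemma fourier_add_const_mul {f g : ℝ → ℂ} (hf : Integrable f) (hg : Integrable g) (c : ℂ) :
    𝓕 (fun x ↦ f x + c * g x) = fun ξ ↦ 𝓕 f ξ + c * 𝓕 g ξ := by
  funext ξ
  simp only [Real.fourier_real_eq_integral_exp_smul]
  have h1 := integrable_exp_mul hf ξ
  have h2 := integrable_exp_mul hg ξ
  simp only [smul_eq_mul] at h1 h2 ⊢
  simp_rw [mul_add]
  rw [integral_add h1 (by simpa [mul_left_comm] using h2.const_mul c), ← integral_const_mul]
  congr 1
  exact integral_congr_ae (Eventually.of_forall fun v ↦ by simp only; ring)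

/-- **Parseval's formula for `L¹ ∩ L²` pairs** (polarisation of Plancherel,
`Literature.Analysis.FunctionSpaces.integral_norm_sq_fourierIntegral_eq`):
`∫ conj(𝓕f) 𝓕g = ∫ conj(f) g`. [folklore] -/
theorem integral_conj_fourier_mul_fourier {f g : ℝ → ℂ} (hf1 : Integrable f) (hf2 : MemLp f 2 volume)
    (hg1 : Integrable g) (hg2 : MemLp g 2 volume) :
    ∫ ξ : ℝ, conj (𝓕 f ξ) * 𝓕 g ξ = ∫ x : ℝ, conj (f x) * g x := by
  have hF2 := Literature.Analysis.FunctionSpaces.memLp_two_fourierIntegral hf1 hf2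
  have hG2 := Literature.Analysis.FunctionSpaces.memLp_two_fourierIntegral hg1 hg2
  have hPf := Literature.Analysis.FunctionSpaces.integral_norm_sq_fourierIntegral_eq hf1 hf2
  have hPg := Literature.Analysis.FunctionSpaces.integral_norm_sq_fourierIntegral_eq hg1 hg2
  -- Plancherel for `f + c g` gives `re(c ∫ conj(𝓕f)𝓕g) = re(c ∫ conj(f) g)` for every `c`
  have key : ∀ c : ℂ, (c * ∫ ξ : ℝ, conj (𝓕 f ξ) * 𝓕 g ξ).re = (c * ∫ x : ℝ, conj (f x) * g x).re := by
    intro c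
    have h1 : Integrable (fun x ↦ f x + c * g x) := hf1.add (hg1.const_mul c)
    have h2 : MemLp (fun x ↦ f x + c * g x) 2 volume := hf2.add (hg2.const_mul c)
    have hP := Literature.Analysis.FunctionSpaces.integral_norm_sq_fourierIntegral_eq h1 h2
    rw [fourier_add_const_mul hf1 hg1 c] at hP
    simp only at hP
    rw [integral_norm_sq_add_mul hF2 hG2 c, integral_norm_sq_add_mul hf2 hg2 c, hPf, hPg] at hP
    linarith
  apply Complex.ext
  · simpa using key 1
  · have h := key (-I)
    simp only [neg_mul, Complex.neg_re, Complex.I_mul_re, neg_neg] at h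
    exact h

end Parseval

/-! ### The model functions `𝟙_{[0,1]} x^k` and the constants `∫ conj(Φ_k(iy)) Φ_l(iy) dy` -/

/-- `‖f_k‖ ≤ 𝟙_{[0,1]}`. [folklore] -/
lemma norm_fMon_le (k : ℕ) (x : ℝ) : ‖fMon k x‖ ≤ (Icc (0 : ℝ) 1).indicator (fun _ ↦ (1 : ℝ)) x := by
  by_cases hx : x ∈ Icc (0 : ℝ) 1
  · rw [fMon, indicator_of_mem hx, indicator_of_mem hx, norm_pow, Complex.norm_real,
      Real.norm_of_nonneg hx.1]
    exact pow_le_one₀ hx.1 hx.2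
  · rw [fMon, indicator_of_notMem hx, indicator_of_notMem hx, norm_zero]

/-- Measurability of `f_k`. [folklore] -/
lemma measurable_fMon (k : ℕ) : Measurable (fMon k) :=
  (by fun_prop : Measurable fun x : ℝ ↦ (x : ℂ) ^ k).indicator measurableSet_Icc

/-- `f_k ∈ L¹`. [folklore] -/
theorem integrable_fMon (k : ℕ) : Integrable (fMon k) := by
  have h1 : Integrable ((Icc (0 : ℝ) 1).indicator fun _ : ℝ ↦ (1 : ℝ)) :=
    (integrableOn_const (hs := measure_Icc_lt_top.ne)).integrable_indicator measurableSet_Icc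
  exact h1.mono' (measurable_fMon k).aestronglyMeasurable (Eventually.of_forall (norm_fMon_le k))

/-- `f_k ∈ L²`. [folklore] -/
theorem memLp_two_fMon (k : ℕ) : MemLp (fMon k) 2 volume := by
  refine (memLp_two_iff_integrable_sq_norm (measurable_fMon k).aestronglyMeasurable).2 ?_
  have h := integrable_fMon (2 * k)
  refine h.norm.congr (Eventually.of_forall fun x ↦ ?_)
  by_cases hx : x ∈ Icc (0 : ℝ) 1
  · simp only [fMon, indicator_of_mem hx, norm_pow, Complex.norm_real, Real.norm_of_nonneg hx.1]
    ring
  · simp only [fMon, indicator_of_notMem hx, norm_zero]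
    norm_num

/-- **The Fourier transform of `f_k`**: `𝓕 f_k(ξ) = (-1)^k Φ_k(-2πiξ)` for `ξ ≠ 0`. [folklore] -/
theorem fourier_fMon {ξ : ℝ} (hξ : ξ ≠ 0) (k : ℕ) :
    𝓕 (fMon k) ξ = (-1) ^ k * phiK k (((-2 * π * ξ : ℝ) : ℂ) * I) := by
  have hz : ((-2 * π * ξ : ℝ) : ℂ) * I ≠ 0 :=
    mul_ne_zero (ofReal_ne_zero.2 (by simp [Real.pi_ne_zero, hξ])) I_ne_zero
  rw [phiK_eq_integral hz, ← mul_assoc, ← mul_pow, show (-1 : ℂ) * -1 = 1 by norm_num, one_pow,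
    one_mul, Real.fourier_real_eq_integral_exp_smul]
  have e : (fun v : ℝ ↦ Complex.exp (((-2 * π * v * ξ : ℝ) : ℂ) * I) • fMon k v) =
      (Icc (0 : ℝ) 1).indicator fun v : ℝ ↦ (v : ℂ) ^ k * Complex.exp (((-2 * π * ξ : ℝ) : ℂ) * I * v) := by
    funext v
    by_cases hv : v ∈ Icc (0 : ℝ) 1
    · rw [fMon, indicator_of_mem hv, indicator_of_mem hv, smul_eq_mul]
      rw [show (((-2 * π * v * ξ : ℝ) : ℂ) * I) = ((-2 * π * ξ : ℝ) : ℂ) * I * v by push_cast; ring]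
      ring
    · rw [fMon, indicator_of_notMem hv, indicator_of_notMem hv, smul_zero]
  rw [e, integral_indicator measurableSet_Icc, intervalIntegral.integral_of_le zero_le_one,
    integral_Icc_eq_integral_Ioc]

/-- `∫ conj(f_k) f_l = 1/(k+l+1)`. [folklore] -/
theorem integral_conj_fMon_mul_fMon (k l : ℕ) :
    ∫ x : ℝ, conj (fMon k x) * fMon l x = 1 / ((k : ℂ) + l + 1) := by
  have e : (fun x : ℝ ↦ conj (fMon k x) * fMon l x) =
      (Icc (0 : ℝ) 1).indicator fun x : ℝ ↦ (x : ℂ) ^ (k + l) := by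
    funext x
    by_cases hx : x ∈ Icc (0 : ℝ) 1
    · rw [fMon, fMon, indicator_of_mem hx, indicator_of_mem hx, indicator_of_mem hx, map_pow,
        Complex.conj_ofReal, pow_add]
    · rw [fMon, indicator_of_notMem hx, indicator_of_notMem hx, map_zero, zero_mul]
  rw [e, integral_indicator measurableSet_Icc, integral_Icc_eq_integral_Ioc,
    ← intervalIntegral.integral_of_le zero_le_one]
  have h2 : ∫ x in (0 : ℝ)..1, (x : ℂ) ^ (k + l) = (((1 : ℝ) / ((k : ℝ) + l + 1) : ℝ) : ℂ) := by
    have e2 : (fun x : ℝ ↦ (x : ℂ) ^ (k + l)) = fun x : ℝ ↦ ((x ^ (k + l) : ℝ) : ℂ) := by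
      funext x; push_cast; rfl
    rw [e2, intervalIntegral.integral_ofReal, integral_pow]
    congr 1
    rw [one_pow, zero_pow (Nat.succ_ne_zero _)]
    push_cast
    ring
  rw [h2]
  push_cast
  ring

/-- `min 1 (2/|y|)² ≤ 8 (1+y²)⁻¹`. [folklore] -/
lemma min_sq_le_inv (y : ℝ) : min 1 (2 / |y|) * min 1 (2 / |y|) ≤ 8 * (1 + y ^ 2)⁻¹ := by
  have hm0 : 0 ≤ min 1 (2 / |y|) := le_min zero_le_one (by positivity)
  rw [← div_eq_mul_inv, le_div_iff₀ (by positivity)]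
  by_cases hy : |y| ≤ 1
  · have h1 : min 1 (2 / |y|) ≤ 1 := min_le_left _ _
    have hy2 : y ^ 2 ≤ 1 := by nlinarith [abs_nonneg y, sq_abs y]
    nlinarith [mul_le_mul h1 h1 hm0 zero_le_one]
  · rw [not_le] at hy
    have hy0 : 0 < |y| := by linarith
    have h1 : min 1 (2 / |y|) ≤ 2 / |y| := min_le_right _ _
    have h2 : min 1 (2 / |y|) * min 1 (2 / |y|) ≤ (2 / |y|) * (2 / |y|) := mul_le_mul h1 h1 hm0 (by positivity)
    have hy2 : 1 ≤ y ^ 2 := by nlinarith [sq_abs y, abs_nonneg y]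
    have h3 : (2 / |y|) * (2 / |y|) * (1 + y ^ 2) ≤ 8 := by
      rw [show (2 / |y|) * (2 / |y|) * (1 + y ^ 2) = 4 * (1 + y ^ 2) / |y| ^ 2 by field_simp; ring,
        div_le_iff₀ (by positivity), sq_abs]
      nlinarith
    nlinarith

/-- **The Gram kernel of the models is integrable**: `y ↦ conj(Φ_k(iy)) Φ_l(iy) ∈ L¹(ℝ)`. [folklore] -/
theorem integrable_conj_phiK_mul_phiK (k l : ℕ) :
    Integrable fun y : ℝ ↦ conj (phiK k (y * I)) * phiK l (y * I) := by
  have hm : Measurable fun y : ℝ ↦ conj (phiK k (y * I)) * phiK l (y * I) :=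
    (continuous_conj.measurable.comp ((measurable_phiK k).comp (by fun_prop))).mul
      ((measurable_phiK l).comp (by fun_prop))
  refine (integrable_and_memLp_two_of_norm_le (C := 8) hm fun y ↦ ?_).1
  by_cases hy : y = 0
  · subst hy; simp [phiK]
  rw [norm_mul, RCLike.norm_conj]
  calc ‖phiK k (y * I)‖ * ‖phiK l (y * I)‖ ≤ min 1 (2 / |y|) * min 1 (2 / |y|) :=
      mul_le_mul (norm_phiK_I_le_min k hy) (norm_phiK_I_le_min l hy) (norm_nonneg _)
        (le_min zero_le_one (by positivity))
    _ ≤ 8 * (1 + y ^ 2)⁻¹ := min_sq_le_inv y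

/-- **The Gram constants of the models** (Parseval): `∫ conj(Φ_k(iy)) Φ_l(iy) dy = (-1)^{k+l} 2π/(k+l+1)`
— the continuous counterpart of the Cauchy matrix `(1/(i+j+1))` in Burnol's Theorem 5.2
("the Gram matrix decomposes into Cauchy blocks `(1/(i+j+1))`"). [cite: Burnol2002, Thm. 5.2 and §2] -/
theorem integral_conj_phiK_mul_phiK (k l : ℕ) :
    ∫ y : ℝ, conj (phiK k (y * I)) * phiK l (y * I) = (-1) ^ (k + l) * (2 * π / ((k : ℂ) + l + 1)) := by
  have hP := integral_conj_fourier_mul_fourier (integrable_fMon k) (memLp_two_fMon k)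
    (integrable_fMon l) (memLp_two_fMon l)
  rw [integral_conj_fMon_mul_fMon] at hP
  -- the left side of Parseval, a.e. in terms of `Φ`
  have hae : ∀ᵐ ξ : ℝ, conj (𝓕 (fMon k) ξ) * 𝓕 (fMon l) ξ =
      (-1) ^ (k + l) * (fun y : ℝ ↦ conj (phiK k (y * I)) * phiK l (y * I)) (-(2 * π) * ξ) := by
    filter_upwards [ae_ne 0] with ξ hξ
    rw [fourier_fMon hξ k, fourier_fMon hξ l, map_mul, map_pow, map_neg, map_one]
    rw [show ((-2 * π * ξ : ℝ) : ℂ) = ((-(2 * π) * ξ : ℝ) : ℂ) by push_cast; ring, pow_add]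
    ring
  rw [integral_congr_ae hae, integral_const_mul, Measure.integral_comp_mul_left
    (fun y : ℝ ↦ conj (phiK k (y * I)) * phiK l (y * I)) (-(2 * π))] at hP
  -- solve for the integral
  have hπ : (π : ℂ) ≠ 0 := by exact_mod_cast Real.pi_ne_zero
  have habs : |(-(2 * π))⁻¹| = (2 * π)⁻¹ := by
    rw [abs_inv, abs_neg, abs_of_pos (by positivity)]
  rw [habs, Complex.real_smul] at hP
  set J : ℂ := ∫ y : ℝ, conj (phiK k (y * I)) * phiK l (y * I) with hJ
  have h1 : ((-1 : ℂ) ^ (k + l)) * (-1) ^ (k + l) = 1 := by rw [← mul_pow]; norm_num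
  have h2 : (2 * π : ℂ) * (((2 * π)⁻¹ : ℝ) : ℂ) = 1 := by push_cast; field_simp
  calc J = ((-1 : ℂ) ^ (k + l) * (-1) ^ (k + l)) * ((2 * π : ℂ) * (((2 * π)⁻¹ : ℝ) : ℂ)) * J := by
        rw [h1, h2, one_mul, one_mul]
    _ = (-1) ^ (k + l) * (2 * π) * ((-1) ^ (k + l) * ((((2 * π)⁻¹ : ℝ) : ℂ) * J)) := by ring
    _ = (-1) ^ (k + l) * (2 * π) * (1 / ((k : ℂ) + l + 1)) := by rw [hP]
    _ = (-1) ^ (k + l) * (2 * π / ((k : ℂ) + l + 1)) := by ring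

/-! ## 5. Gram asymptotics -/

/-- `‖G_{kl}(y)‖ ≤ 8 (1+y²)⁻¹`. [folklore] -/
lemma norm_gramKer_le (k l : ℕ) (y : ℝ) : ‖gramKer k l y‖ ≤ 8 * (1 + y ^ 2)⁻¹ := by
  by_cases hy : y = 0
  · subst hy; simp [gramKer, phiK]
  rw [gramKer, norm_mul, RCLike.norm_conj]
  calc ‖phiK k (y * I)‖ * ‖phiK l (y * I)‖ ≤ min 1 (2 / |y|) * min 1 (2 / |y|) :=
      mul_le_mul (norm_phiK_I_le_min k hy) (norm_phiK_I_le_min l hy) (norm_nonneg _)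
        (le_min zero_le_one (by positivity))
    _ ≤ 8 * (1 + y ^ 2)⁻¹ := min_sq_le_inv y

/-- Measurability of `G_{kl}`. [folklore] -/
lemma measurable_gramKer (k l : ℕ) : Measurable (gramKer k l) :=
  (continuous_conj.measurable.comp ((measurable_phiK k).comp (by fun_prop))).mul
    ((measurable_phiK l).comp (by fun_prop))

/-- **Substitution `τ = γ + y/L`**: `∫ w(τ) conj(M_k) M_l dτ = L^{k+l+1} ∫ w(γ + y/L) G_{kl}(y) dy`
(`0 < λ < 1`). [folklore] -/
theorem integral_wR_conj_Mk_mul_Mk_eq {lam : ℝ} (h0 : 0 < lam) (h1 : lam < 1) (k l : ℕ) (γ : ℝ) :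
    ∫ τ : ℝ, (wR τ : ℂ) * (conj (Mk k lam γ τ) * Mk l lam γ τ) =
      (Lof lam : ℂ) ^ (k + l + 1) * ∫ y : ℝ, (wR (γ + y / Lof lam) : ℂ) * gramKer k l y := by
  have hL := Lof_pos h0 h1
  have hL0 : (Lof lam : ℂ) ≠ 0 := by exact_mod_cast hL.ne'
  set H2 : ℝ → ℂ := fun y ↦ (wR (γ + y / Lof lam) : ℂ) * gramKer k l y with hH2
  set H : ℝ → ℂ := fun v ↦ (wR (γ + v) : ℂ) * gramKer k l (Lof lam * v) with hH
  -- pointwise form of the integrand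
  have e1 : ∀ τ : ℝ, (wR τ : ℂ) * (conj (Mk k lam γ τ) * Mk l lam γ τ) =
      (Lof lam : ℂ) ^ (k + l + 2) * H (τ - γ) := by
    intro τ
    simp only [hH, gramKer]
    rw [Mk_eq, Mk_eq, map_mul, map_pow, Complex.conj_ofReal, add_sub_cancel,
      show ((Lof lam * (τ - γ) : ℝ) : ℂ) = (((Lof lam * (τ - γ)) : ℝ) : ℂ) from rfl]
    ring
  have e2 : ∀ v : ℝ, H v = H2 (Lof lam * v) := by
    intro v
    simp only [hH, hH2]
    rw [mul_div_cancel_left₀ v hL.ne']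
  simp_rw [e1]
  rw [integral_const_mul, integral_sub_right_eq_self H γ]
  simp_rw [e2]
  rw [Measure.integral_comp_mul_left H2 (Lof lam), abs_of_pos (inv_pos.2 hL), Complex.real_smul]
  push_cast
  field_simp
  ring

/-- **Dominated convergence for the rescaled Gram integral**:
`∫ w(γ + y/L) G_{kl}(y) dy → w(γ) · (-1)^{k+l} 2π/(k+l+1)` as `λ → 0⁺`. [cite: Burnol2002, Thm. 5.2 (proof)] -/
theorem tendsto_integral_wR_shift_gramKer (k l : ℕ) (γ : ℝ) :
    Tendsto (fun lam : ℝ ↦ ∫ y : ℝ, (wR (γ + y / Lof lam) : ℂ) * gramKer k l y) (𝓝[>] 0)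
      (𝓝 ((wR γ : ℂ) * ((-1) ^ (k + l) * (2 * π / ((k : ℂ) + l + 1))))) := by
  have hG : Integrable (gramKer k l) := integrable_conj_phiK_mul_phiK k l
  rw [← integral_conj_phiK_mul_phiK, ← integral_const_mul]
  refine tendsto_integral_filter_of_dominated_convergence (fun y ↦ 64 * ‖gramKer k l y‖) ?_ ?_ ?_ ?_
  · refine Eventually.of_forall fun lam ↦ ?_
    refine ((Complex.continuous_ofReal.measurable.comp (continuous_wR.measurable.comp ?_)).mul
      (measurable_gramKer k l)).aestronglyMeasurable
    fun_prop
  · refine Eventually.of_forall fun lam ↦ Eventually.of_forall fun y ↦ ?_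
    rw [norm_mul, Complex.norm_real, Real.norm_of_nonneg (wR_nonneg _)]
    gcongr
    exact wR_le _
  · exact hG.norm.const_mul 64
  · refine Eventually.of_forall fun y ↦ ?_
    refine Tendsto.mul_const _ ?_
    have h1 : Tendsto (fun lam : ℝ ↦ γ + y / Lof lam) (𝓝[>] 0) (𝓝 γ) := by
      have := (tendsto_inv_Lof.const_mul y).const_add γ
      simp only [mul_zero, add_zero] at this
      exact this.congr fun lam ↦ by simp [div_eq_mul_inv]
    exact (Complex.continuous_ofReal.tendsto _).comp ((continuous_wR.tendsto γ).comp h1)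

/-- On the line `conj(r) r = w` (as complex numbers) and `conj(W) W = 1`. [folklore] -/
lemma conj_burnolR_mul_self (τ : ℝ) :
    conj (burnolR ((1 / 2 : ℂ) + τ * I)) * burnolR ((1 / 2 : ℂ) + τ * I) = (wR τ : ℂ) := by
  rw [Complex.conj_mul', wR]; push_cast; rfl

/-- `conj(W) W = 1` on the line. [folklore] -/
lemma conj_Wf_mul_self (γ τ : ℝ) :
    conj (Wf ((1 / 2 : ℂ) + γ * I) ((1 / 2 : ℂ) + τ * I)) * Wf ((1 / 2 : ℂ) + γ * I) ((1 / 2 : ℂ) + τ * I) = 1 := by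
  rw [Complex.conj_mul', norm_Wf_line]; norm_num

/-- `L ≥ 1` and `n ≥ 1` give `L⁻ⁿ ≤ L⁻¹`. [folklore] -/
lemma inv_pow_le_inv {L : ℝ} (hL : 1 ≤ L) {n : ℕ} (hn : 1 ≤ n) : (L ^ n)⁻¹ ≤ L⁻¹ := by
  have hL0 : 0 < L := by linarith
  rw [inv_le_inv₀ (pow_pos hL0 n) hL0]
  exact le_self_pow₀ hL (by omega)

/-- **Gram asymptotics, same zero** (Burnol, Thm. 5.2: "`lim (X^λ_{ρ,k}, X^λ_{ρ,l}) = 1/(k+l+1)`",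
Mellin side): `L^{-(k+l+1)} ∫ conj(K_k) K_l dτ → w(γ) (-1)^{k+l} 2π/(k+l+1)` as `λ → 0⁺`, where
`w(γ) = |r(ρ)|²`. The main term is the rescaled model Gram integral (substitution `τ = γ + y/L`,
dominated convergence and the Parseval constants `integral_conj_phiK_mul_phiK`); the terms
involving the bounded remainders `Z_k`, `Z_l` are `O(L^{max(k,l)+1})` and disappear. [cite: Burnol2002, Thm. 5.2] -/
theorem tendsto_integral_conj_burnolKk_mul_burnolKk (γ : ℝ) (k l : ℕ) :
    Tendsto (fun lam : ℝ ↦ ((Lof lam : ℂ) ^ (k + l + 1))⁻¹ *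
      ∫ τ : ℝ, conj (burnolKk ((1 / 2 : ℂ) + γ * I) k lam ((1 / 2 : ℂ) + τ * I)) *
        burnolKk ((1 / 2 : ℂ) + γ * I) l lam ((1 / 2 : ℂ) + τ * I)) (𝓝[>] 0)
      (𝓝 ((wR γ : ℂ) * ((-1) ^ (k + l) * (2 * π / ((k : ℂ) + l + 1))))) := by
  set ρ : ℂ := (1 / 2 : ℂ) + γ * I with hρdef
  obtain ⟨D, hD0, hD⟩ := exists_norm_Zk_line_le γ k
  obtain ⟨D', hD0', hD'⟩ := exists_norm_Zk_line_le γ l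
  -- the main term and the remainder
  set A : ℝ → ℝ → ℂ := fun lam τ ↦ (wR τ : ℂ) * (conj (Mk k lam γ τ) * Mk l lam γ τ) with hA
  set R : ℝ → ℝ → ℂ := fun lam τ ↦ (wR τ : ℂ) *
    ((k ! : ℂ) * l ! * (conj (Zk ρ k ((1 / 2 : ℂ) + τ * I)) * Zk ρ l ((1 / 2 : ℂ) + τ * I)) +
      (k ! : ℂ) * (conj (Zk ρ k ((1 / 2 : ℂ) + τ * I)) * (Wf ρ ((1 / 2 : ℂ) + τ * I) * Mk l lam γ τ)) +
      (l ! : ℂ) * (conj (Wf ρ ((1 / 2 : ℂ) + τ * I) * Mk k lam γ τ) * Zk ρ l ((1 / 2 : ℂ) + τ * I)))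
    with hR
  have hdec : ∀ lam τ : ℝ, conj (burnolKk ρ k lam ((1 / 2 : ℂ) + τ * I)) *
      burnolKk ρ l lam ((1 / 2 : ℂ) + τ * I) = A lam τ + R lam τ := by
    intro lam τ
    have hw := conj_burnolR_mul_self τ
    have hW := conj_Wf_mul_self γ τ
    rw [← hρdef] at hW
    simp only [hA, hR]
    rw [burnolKk_line_eq, burnolKk_line_eq, ← hρdef]
    simp only [map_mul, map_neg, map_add, map_natCast]
    linear_combination ((↑k ! * conj (Zk ρ k ((1 / 2 : ℂ) + ↑τ * I)) +
        conj (Wf ρ ((1 / 2 : ℂ) + ↑τ * I)) * conj (Mk k lam γ τ)) *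
      (↑l ! * Zk ρ l ((1 / 2 : ℂ) + ↑τ * I) + Wf ρ ((1 / 2 : ℂ) + ↑τ * I) * Mk l lam γ τ)) * hw +
      ((wR τ : ℂ) * conj (Mk k lam γ τ) * Mk l lam γ τ) * hW
  -- measurability facts
  have hmZ : ∀ j, Measurable fun τ : ℝ ↦ Zk ρ j ((1 / 2 : ℂ) + τ * I) := fun j ↦ (continuous_Zk_line γ j).measurable
  have hmW : Measurable fun τ : ℝ ↦ Wf ρ ((1 / 2 : ℂ) + τ * I) := (continuous_Wf_line ρ).measurable
  have hmw : Measurable fun τ : ℝ ↦ (wR τ : ℂ) := Complex.continuous_ofReal.measurable.comp continuous_wR.measurable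
  have hmA : ∀ lam, Measurable (A lam) := fun lam ↦
    hmw.mul ((continuous_conj.measurable.comp (measurable_Mk k lam γ)).mul (measurable_Mk l lam γ))
  have hmR : ∀ lam, Measurable (R lam) := by
    intro lam
    simp only [hR]
    refine hmw.mul (Measurable.add (Measurable.add ?_ ?_) ?_)
    · exact ((continuous_conj.measurable.comp (hmZ k)).mul (hmZ l)).const_mul _
    · exact ((continuous_conj.measurable.comp (hmZ k)).mul (hmW.mul (measurable_Mk l lam γ))).const_mul _
    · exact ((continuous_conj.measurable.comp (hmW.mul (measurable_Mk k lam γ))).mul (hmZ l)).const_mul _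
  -- integrability (both dominated by multiples of `w`)
  have hIA : ∀ {lam : ℝ}, 0 < lam → lam < 1 → Integrable (A lam) := by
    intro lam h0 h1
    refine Integrable.mono' (integrable_wR.const_mul (Lof lam ^ (k + 1) * Lof lam ^ (l + 1)))
      (hmA lam).aestronglyMeasurable (Eventually.of_forall fun τ ↦ ?_)
    simp only [hA, norm_mul, Complex.norm_real, Real.norm_of_nonneg (wR_nonneg τ), RCLike.norm_conj]
    rw [mul_comm (Lof lam ^ (k + 1) * Lof lam ^ (l + 1))]
    exact mul_le_mul_of_nonneg_left (mul_le_mul (norm_Mk_le h0 h1 k γ τ).1 (norm_Mk_le h0 h1 l γ τ).1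
      (norm_nonneg _) (pow_nonneg (Lof_pos h0 h1).le _)) (wR_nonneg τ)
  have hRbound : ∀ {lam : ℝ}, 0 < lam → lam < 1 → ∀ τ : ℝ, ‖R lam τ‖ ≤
      wR τ * (k ! * l ! * (D * D') + k ! * (D * Lof lam ^ (l + 1)) + l ! * (Lof lam ^ (k + 1) * D')) := by
    intro lam h0 h1 τ
    have hL := Lof_pos h0 h1
    have hW1 : ‖Wf ρ ((1 / 2 : ℂ) + τ * I)‖ = 1 := by rw [hρdef]; exact norm_Wf_line γ τ
    simp only [hR, norm_mul, Complex.norm_real, Real.norm_of_nonneg (wR_nonneg τ)]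
    refine mul_le_mul_of_nonneg_left ?_ (wR_nonneg τ)
    refine (norm_add_le _ _).trans (add_le_add ((norm_add_le _ _).trans (add_le_add ?_ ?_)) ?_)
    · rw [norm_mul, norm_mul, norm_mul, Complex.norm_natCast, Complex.norm_natCast, RCLike.norm_conj]
      exact mul_le_mul_of_nonneg_left (mul_le_mul (hD τ) (hD' τ) (norm_nonneg _) hD0) (by positivity)
    · rw [norm_mul, norm_mul, norm_mul, Complex.norm_natCast, RCLike.norm_conj, hW1, one_mul]
      exact mul_le_mul_of_nonneg_left (mul_le_mul (hD τ) (norm_Mk_le h0 h1 l γ τ).1 (norm_nonneg _) hD0)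
        (by positivity)
    · rw [norm_mul, norm_mul, Complex.norm_natCast, RCLike.norm_conj, norm_mul, hW1, one_mul]
      exact mul_le_mul_of_nonneg_left (mul_le_mul (norm_Mk_le h0 h1 k γ τ).1 (hD' τ) (norm_nonneg _)
        (pow_nonneg hL.le _)) (by positivity)
  have hIR : ∀ {lam : ℝ}, 0 < lam → lam < 1 → Integrable (R lam) := fun h0 h1 ↦
    Integrable.mono' (integrable_wR.mul_const _) (hmR _).aestronglyMeasurable
      (Eventually.of_forall (hRbound h0 h1))
  ------------------------------------------------------------------
  -- limit of the main term
  ------------------------------------------------------------------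
  have hLA : Tendsto (fun lam : ℝ ↦ ((Lof lam : ℂ) ^ (k + l + 1))⁻¹ * ∫ τ, A lam τ) (𝓝[>] 0)
      (𝓝 ((wR γ : ℂ) * ((-1) ^ (k + l) * (2 * π / ((k : ℂ) + l + 1))))) := by
    refine (tendsto_integral_wR_shift_gramKer k l γ).congr' ?_
    filter_upwards [eventually_mem_Ioo] with lam hlam
    have hL0 : (Lof lam : ℂ) ≠ 0 := by exact_mod_cast (Lof_pos hlam.1 hlam.2).ne'
    simp only [hA]
    rw [integral_wR_conj_Mk_mul_Mk_eq hlam.1 hlam.2 k l γ, ← mul_assoc, inv_mul_cancel₀ (pow_ne_zero _ hL0),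
      one_mul]
  ------------------------------------------------------------------
  -- the remainder tends to zero (dominated convergence)
  ------------------------------------------------------------------
  set B : ℝ := k ! * l ! * (D * D') + k ! * D + l ! * D' with hB
  have hLR : Tendsto (fun lam : ℝ ↦ ((Lof lam : ℂ) ^ (k + l + 1))⁻¹ * ∫ τ, R lam τ) (𝓝[>] 0) (𝓝 0) := by
    simp_rw [← integral_const_mul]
    have key := tendsto_integral_filter_of_dominated_convergence
      (F := fun (lam τ : ℝ) ↦ ((Lof lam : ℂ) ^ (k + l + 1))⁻¹ * R lam τ)
      (f := fun _ ↦ (0 : ℂ)) (l := 𝓝[>] (0 : ℝ)) (μ := volume) (fun τ ↦ B * wR τ) ?_ ?_ ?_ ?_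
    · rw [integral_zero] at key; exact key
    · exact Eventually.of_forall fun lam ↦ ((hmR lam).const_mul _).aestronglyMeasurable
    · filter_upwards [eventually_mem_Ioo, eventually_one_le_Lof] with lam hlam hL1
      refine Eventually.of_forall fun τ ↦ ?_
      have hL := Lof_pos hlam.1 hlam.2
      have hLn : ‖((Lof lam : ℂ) ^ (k + l + 1))⁻¹‖ = (Lof lam ^ (k + l + 1))⁻¹ := by
        rw [norm_inv, norm_pow, norm_real, Real.norm_of_nonneg hL.le]
      rw [norm_mul, hLn]
      refine (mul_le_mul_of_nonneg_left (hRbound hlam.1 hlam.2 τ) (by positivity)).trans ?_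
      -- `L^{-(k+l+1)} (k!l!DD' + k!D L^{l+1} + l! L^{k+1} D') ≤ B`
      have h1 : (Lof lam ^ (k + l + 1))⁻¹ * (k ! * l ! * (D * D')) ≤ k ! * l ! * (D * D') := by
        rw [inv_mul_le_iff₀ (by positivity)]
        exact le_mul_of_one_le_left (by positivity) (one_le_pow₀ hL1)
      have h2 : (Lof lam ^ (k + l + 1))⁻¹ * (k ! * (D * Lof lam ^ (l + 1))) ≤ k ! * D := by
        rw [inv_mul_le_iff₀ (by positivity), show Lof lam ^ (k + l + 1) * (k ! * D) =
          k ! * (D * (Lof lam ^ k * Lof lam ^ (l + 1))) by ring]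
        gcongr
        exact le_mul_of_one_le_left (by positivity) (one_le_pow₀ hL1)
      have h3 : (Lof lam ^ (k + l + 1))⁻¹ * (l ! * (Lof lam ^ (k + 1) * D')) ≤ l ! * D' := by
        rw [inv_mul_le_iff₀ (by positivity), show Lof lam ^ (k + l + 1) * (l ! * D') =
          l ! * ((Lof lam ^ (k + 1) * Lof lam ^ l) * D') by ring]
        gcongr
        exact le_mul_of_one_le_right (by positivity) (one_le_pow₀ hL1)
      calc (Lof lam ^ (k + l + 1))⁻¹ * (wR τ * (k ! * l ! * (D * D') + k ! * (D * Lof lam ^ (l + 1)) +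
            l ! * (Lof lam ^ (k + 1) * D')))
          = wR τ * ((Lof lam ^ (k + l + 1))⁻¹ * (k ! * l ! * (D * D')) +
              (Lof lam ^ (k + l + 1))⁻¹ * (k ! * (D * Lof lam ^ (l + 1))) +
              (Lof lam ^ (k + l + 1))⁻¹ * (l ! * (Lof lam ^ (k + 1) * D'))) := by ring
        _ ≤ wR τ * (k ! * l ! * (D * D') + k ! * D + l ! * D') :=
            mul_le_mul_of_nonneg_left (by linarith) (wR_nonneg τ)
        _ = B * wR τ := by rw [hB]; ring
    · exact integrable_wR.const_mul B
    · filter_upwards [ae_ne γ] with τ hτ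
      have hv : 0 < |τ - γ| := abs_pos.2 (sub_ne_zero.2 hτ)
      set B' : ℝ := wR τ * (k ! * l ! * (D * D') + k ! * (D * (2 / |τ - γ|)) + l ! * ((2 / |τ - γ|) * D'))
        with hB'
      have hup : Tendsto (fun lam : ℝ ↦ (Lof lam)⁻¹ * B') (𝓝[>] 0) (𝓝 0) := by
        simpa using tendsto_inv_Lof.mul_const B'
      refine squeeze_zero_norm' ?_ hup
      filter_upwards [eventually_mem_Ioo, eventually_one_le_Lof] with lam hlam hL1
      have hL := Lof_pos hlam.1 hlam.2
      have hLn : ‖((Lof lam : ℂ) ^ (k + l + 1))⁻¹‖ = (Lof lam ^ (k + l + 1))⁻¹ := by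
        rw [norm_inv, norm_pow, norm_real, Real.norm_of_nonneg hL.le]
      rw [norm_mul, hLn]
      -- pointwise bound with the `2L^j/|τ-γ|` envelopes
      have hW1 : ‖Wf ρ ((1 / 2 : ℂ) + τ * I)‖ = 1 := by rw [hρdef]; exact norm_Wf_line γ τ
      have hRpt : ‖R lam τ‖ ≤ wR τ * (k ! * l ! * (D * D') + k ! * (D * (2 * Lof lam ^ l / |τ - γ|)) +
          l ! * ((2 * Lof lam ^ k / |τ - γ|) * D')) := by
        simp only [hR, norm_mul, Complex.norm_real, Real.norm_of_nonneg (wR_nonneg τ)]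
        refine mul_le_mul_of_nonneg_left ?_ (wR_nonneg τ)
        refine (norm_add_le _ _).trans (add_le_add ((norm_add_le _ _).trans (add_le_add ?_ ?_)) ?_)
        · rw [norm_mul, norm_mul, norm_mul, Complex.norm_natCast, Complex.norm_natCast, RCLike.norm_conj]
          exact mul_le_mul_of_nonneg_left (mul_le_mul (hD τ) (hD' τ) (norm_nonneg _) hD0) (by positivity)
        · rw [norm_mul, norm_mul, norm_mul, Complex.norm_natCast, RCLike.norm_conj, hW1, one_mul]
          exact mul_le_mul_of_nonneg_left (mul_le_mul (hD τ) ((norm_Mk_le hlam.1 hlam.2 l γ τ).2 hτ)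
            (norm_nonneg _) hD0) (by positivity)
        · rw [norm_mul, norm_mul, Complex.norm_natCast, RCLike.norm_conj, norm_mul, hW1, one_mul]
          exact mul_le_mul_of_nonneg_left (mul_le_mul ((norm_Mk_le hlam.1 hlam.2 k γ τ).2 hτ) (hD' τ)
            (norm_nonneg _) (by positivity)) (by positivity)
      refine (mul_le_mul_of_nonneg_left hRpt (by positivity)).trans ?_
      have i0 : (Lof lam ^ (k + l + 1))⁻¹ ≤ (Lof lam)⁻¹ := inv_pow_le_inv hL1 (by omega)
      have h1 : (Lof lam ^ (k + l + 1))⁻¹ * (k ! * l ! * (D * D')) ≤ (Lof lam)⁻¹ * (k ! * l ! * (D * D')) :=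
        mul_le_mul_of_nonneg_right i0 (by positivity)
      have h2 : (Lof lam ^ (k + l + 1))⁻¹ * (k ! * (D * (2 * Lof lam ^ l / |τ - γ|))) ≤
          (Lof lam)⁻¹ * (k ! * (D * (2 / |τ - γ|))) := by
        rw [show (Lof lam ^ (k + l + 1))⁻¹ * (k ! * (D * (2 * Lof lam ^ l / |τ - γ|))) =
          (Lof lam ^ (k + 1))⁻¹ * (k ! * (D * (2 / |τ - γ|))) by field_simp; ring]
        exact mul_le_mul_of_nonneg_right (inv_pow_le_inv hL1 (by omega)) (by positivity)
      have h3 : (Lof lam ^ (k + l + 1))⁻¹ * (l ! * ((2 * Lof lam ^ k / |τ - γ|) * D')) ≤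
          (Lof lam)⁻¹ * (l ! * ((2 / |τ - γ|) * D')) := by
        rw [show (Lof lam ^ (k + l + 1))⁻¹ * (l ! * ((2 * Lof lam ^ k / |τ - γ|) * D')) =
          (Lof lam ^ (l + 1))⁻¹ * (l ! * ((2 / |τ - γ|) * D')) by field_simp; ring]
        exact mul_le_mul_of_nonneg_right (inv_pow_le_inv hL1 (by omega)) (by positivity)
      calc (Lof lam ^ (k + l + 1))⁻¹ * (wR τ * (k ! * l ! * (D * D') + k ! * (D * (2 * Lof lam ^ l / |τ - γ|)) +
            l ! * ((2 * Lof lam ^ k / |τ - γ|) * D')))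
          = wR τ * ((Lof lam ^ (k + l + 1))⁻¹ * (k ! * l ! * (D * D')) +
              (Lof lam ^ (k + l + 1))⁻¹ * (k ! * (D * (2 * Lof lam ^ l / |τ - γ|))) +
              (Lof lam ^ (k + l + 1))⁻¹ * (l ! * ((2 * Lof lam ^ k / |τ - γ|) * D'))) := by ring
        _ ≤ wR τ * ((Lof lam)⁻¹ * (k ! * l ! * (D * D')) + (Lof lam)⁻¹ * (k ! * (D * (2 / |τ - γ|))) +
              (Lof lam)⁻¹ * (l ! * ((2 / |τ - γ|) * D'))) :=
            mul_le_mul_of_nonneg_left (by linarith) (wR_nonneg τ)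
        _ = (Lof lam)⁻¹ * B' := by rw [hB']; ring
  ------------------------------------------------------------------
  -- conclusion
  ------------------------------------------------------------------
  have hsum := hLA.add hLR
  rw [add_zero] at hsum
  refine hsum.congr' ?_
  filter_upwards [eventually_mem_Ioo] with lam hlam
  rw [← mul_add, ← integral_add (hIA hlam.1 hlam.2) (hIR hlam.1 hlam.2)]
  congr 1
  exact integral_congr_ae (Eventually.of_forall fun τ ↦ (hdec lam τ).symm)

/-- `‖K_k‖ ≤ ‖r‖ (k! D + L^k min(L, 2/|τ-γ|))` for `τ ≠ γ`. [folklore] -/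
theorem norm_burnolKk_line_le_min {lam : ℝ} (h0 : 0 < lam) (h1 : lam < 1) {γ : ℝ} {k : ℕ} {D : ℝ}
    (hD : ∀ τ : ℝ, ‖Zk ((1 / 2 : ℂ) + γ * I) k ((1 / 2 : ℂ) + τ * I)‖ ≤ D) {τ : ℝ} (hτ : τ ≠ γ) :
    ‖burnolKk ((1 / 2 : ℂ) + γ * I) k lam ((1 / 2 : ℂ) + τ * I)‖ ≤
      ‖burnolR ((1 / 2 : ℂ) + τ * I)‖ * (k ! * D + Lof lam ^ k * min (Lof lam) (2 / |τ - γ|)) := by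
  obtain ⟨ha, hb⟩ := norm_burnolKk_line_le h0 h1 hD τ
  have hL := (Lof_pos h0 h1).le
  rcases le_total (Lof lam) (2 / |τ - γ|) with h | h
  · rw [min_eq_left h, ← pow_succ]; exact ha
  · rw [min_eq_right h, show Lof lam ^ k * (2 / |τ - γ|) = 2 * Lof lam ^ k / |τ - γ| by ring]
    exact hb hτ

/-- **Gram asymptotics, distinct zeros** (Burnol, Thm. 5.2: "`lim (X^λ_{ρ₁,k}, X^λ_{ρ₂,l}) = 0
(ρ₁ ≠ ρ₂)`", Mellin side): for `γ ≠ γ'`, `L^{-(k+l+1)} ∫ conj(K_{γ,k}) K_{γ',l} dτ → 0`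
(dominated convergence with the tree's `cross_bound_aux`). [cite: Burnol2002, Thm. 5.2] -/
theorem tendsto_integral_conj_burnolKk_mul_burnolKk_of_ne {γ γ' : ℝ} (hne : γ ≠ γ') (k l : ℕ) :
    Tendsto (fun lam : ℝ ↦ ((Lof lam : ℂ) ^ (k + l + 1))⁻¹ *
      ∫ τ : ℝ, conj (burnolKk ((1 / 2 : ℂ) + γ * I) k lam ((1 / 2 : ℂ) + τ * I)) *
        burnolKk ((1 / 2 : ℂ) + γ' * I) l lam ((1 / 2 : ℂ) + τ * I)) (𝓝[>] 0) (𝓝 0) := by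
  obtain ⟨D, hD0, hD⟩ := exists_norm_Zk_line_le γ k
  obtain ⟨D', hD0', hD'⟩ := exists_norm_Zk_line_le γ' l
  set δ := |γ - γ'| with hδdef
  have hδ : 0 < δ := abs_pos.2 (sub_ne_zero.2 hne)
  set B := 4 / δ + k ! * D + l ! * D' + (k ! * D) * (l ! * D') with hB
  -- dominated convergence for the norms
  have key := tendsto_integral_filter_of_dominated_convergence
    (F := fun (lam τ : ℝ) ↦ (Lof lam ^ (k + l + 1))⁻¹ *
      (‖burnolKk ((1 / 2 : ℂ) + γ * I) k lam ((1 / 2 : ℂ) + τ * I)‖ *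
        ‖burnolKk ((1 / 2 : ℂ) + γ' * I) l lam ((1 / 2 : ℂ) + τ * I)‖))
    (f := fun _ ↦ (0 : ℝ)) (l := 𝓝[>] (0 : ℝ)) (μ := volume) (fun τ ↦ B * wR τ) ?_ ?_ ?_ ?_
  · rw [integral_zero] at key
    rw [tendsto_zero_iff_norm_tendsto_zero]
    refine squeeze_zero' (Eventually.of_forall fun _ ↦ norm_nonneg _) ?_ key
    filter_upwards [eventually_mem_Ioo] with lam hlam
    have hL := Lof_pos hlam.1 hlam.2
    have hLn : ‖((Lof lam : ℂ) ^ (k + l + 1))⁻¹‖ = (Lof lam ^ (k + l + 1))⁻¹ := by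
      rw [norm_inv, norm_pow, norm_real, Real.norm_of_nonneg hL.le]
    rw [norm_mul, hLn, integral_const_mul]
    refine (mul_le_mul_of_nonneg_left (norm_integral_le_integral_norm _) (by positivity)).trans ?_
    refine le_of_eq ?_
    congr 1
    exact integral_congr_ae (Eventually.of_forall fun τ ↦ by simp only [norm_mul, RCLike.norm_conj])
  · refine Eventually.of_forall fun lam ↦ ?_
    exact (((measurable_burnolKk_line γ k lam).norm.mul (measurable_burnolKk_line γ' l lam).norm).const_mul
      _).aestronglyMeasurable
  · filter_upwards [eventually_mem_Ioo, eventually_one_le_Lof] with lam hlam hL1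
    have hL := Lof_pos hlam.1 hlam.2
    have hae : ∀ᵐ τ : ℝ, τ ≠ γ ∧ τ ≠ γ' := by
      filter_upwards [ae_ne γ, ae_ne γ'] with τ h1 h2; exact ⟨h1, h2⟩
    filter_upwards [hae] with τ ⟨hτ, hτ'⟩
    rw [Real.norm_eq_abs, abs_of_nonneg (by positivity)]
    have hk := norm_burnolKk_line_le_min hlam.1 hlam.2 hD hτ
    have hk' := norm_burnolKk_line_le_min hlam.1 hlam.2 hD' hτ'
    have huu' : δ ≤ |(τ - γ) - (τ - γ')| := by
      rw [show (τ - γ) - (τ - γ') = -(γ - γ') by ring, abs_neg]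
    have hcb := cross_bound_aux hL1 (by positivity : (0 : ℝ) ≤ k ! * D) (by positivity : (0 : ℝ) ≤ l ! * D') hδ huu'
    -- `k! D + L^k m ≤ L^k (m + k! D)` for `L ≥ 1`
    have e1 : (k ! : ℝ) * D + Lof lam ^ k * min (Lof lam) (2 / |τ - γ|) ≤
        Lof lam ^ k * (min (Lof lam) (2 / |τ - γ|) + k ! * D) := by
      rw [mul_add]
      linarith [le_mul_of_one_le_left (by positivity : (0 : ℝ) ≤ k ! * D) (one_le_pow₀ (n := k) hL1)]
    have e2 : (l ! : ℝ) * D' + Lof lam ^ l * min (Lof lam) (2 / |τ - γ'|) ≤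
        Lof lam ^ l * (min (Lof lam) (2 / |τ - γ'|) + l ! * D') := by
      rw [mul_add]
      linarith [le_mul_of_one_le_left (by positivity : (0 : ℝ) ≤ l ! * D') (one_le_pow₀ (n := l) hL1)]
    have hm0 : 0 ≤ min (Lof lam) (2 / |τ - γ|) := le_min hL.le (by positivity)
    have hm0' : 0 ≤ min (Lof lam) (2 / |τ - γ'|) := le_min hL.le (by positivity)
    calc (Lof lam ^ (k + l + 1))⁻¹ * (‖burnolKk ((1 / 2 : ℂ) + γ * I) k lam ((1 / 2 : ℂ) + τ * I)‖ *
          ‖burnolKk ((1 / 2 : ℂ) + γ' * I) l lam ((1 / 2 : ℂ) + τ * I)‖)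
        ≤ (Lof lam ^ (k + l + 1))⁻¹ *
            ((‖burnolR ((1 / 2 : ℂ) + τ * I)‖ * (Lof lam ^ k * (min (Lof lam) (2 / |τ - γ|) + k ! * D))) *
             (‖burnolR ((1 / 2 : ℂ) + τ * I)‖ * (Lof lam ^ l * (min (Lof lam) (2 / |τ - γ'|) + l ! * D')))) := by
          gcongr
          · exact hk.trans (mul_le_mul_of_nonneg_left e1 (norm_nonneg _))
          · exact hk'.trans (mul_le_mul_of_nonneg_left e2 (norm_nonneg _))
      _ = ((Lof lam)⁻¹ * ((min (Lof lam) (2 / |τ - γ|) + k ! * D) * (min (Lof lam) (2 / |τ - γ'|) + l ! * D'))) *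
            wR τ := by
          rw [wR]; field_simp; ring
      _ ≤ B * wR τ := mul_le_mul_of_nonneg_right hcb (wR_nonneg τ)
  · exact integrable_wR.const_mul B
  · have hae : ∀ᵐ τ : ℝ, τ ≠ γ ∧ τ ≠ γ' := by
      filter_upwards [ae_ne γ, ae_ne γ'] with τ h1 h2; exact ⟨h1, h2⟩
    filter_upwards [hae] with τ ⟨hτ, hτ'⟩
    have hu : 0 < |τ - γ| := abs_pos.2 (sub_ne_zero.2 hτ)
    have hu' : 0 < |τ - γ'| := abs_pos.2 (sub_ne_zero.2 hτ')
    set B' : ℝ := ((2 / |τ - γ| + k ! * D) * 8) * ((2 / |τ - γ'| + l ! * D') * 8) with hB'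
    have hup : Tendsto (fun lam : ℝ ↦ (Lof lam)⁻¹ * B') (𝓝[>] 0) (𝓝 0) := by
      simpa using tendsto_inv_Lof.mul_const B'
    refine squeeze_zero' ?_ ?_ hup
    · filter_upwards [eventually_mem_Ioo] with lam hlam
      exact mul_nonneg (inv_nonneg.2 (pow_nonneg (Lof_pos hlam.1 hlam.2).le _)) (by positivity)
    · filter_upwards [eventually_mem_Ioo, eventually_one_le_Lof] with lam hlam hL1
      have hL := Lof_pos hlam.1 hlam.2
      have hk := norm_burnolKk_line_le_min hlam.1 hlam.2 hD hτ
      have hk' := norm_burnolKk_line_le_min hlam.1 hlam.2 hD' hτ'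
      have hr := norm_burnolR_line_le τ
      have e1 : ‖burnolKk ((1 / 2 : ℂ) + γ * I) k lam ((1 / 2 : ℂ) + τ * I)‖ ≤
          Lof lam ^ k * ((2 / |τ - γ| + k ! * D) * 8) := by
        refine hk.trans ?_
        rw [show Lof lam ^ k * ((2 / |τ - γ| + k ! * D) * 8) = 8 * (Lof lam ^ k * (k ! * D) +
          Lof lam ^ k * (2 / |τ - γ|)) by ring]
        refine mul_le_mul hr (add_le_add ?_ ?_) (by positivity) (by norm_num)
        · exact le_mul_of_one_le_left (by positivity) (one_le_pow₀ hL1)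
        · exact mul_le_mul_of_nonneg_left (min_le_right _ _) (by positivity)
      have e2 : ‖burnolKk ((1 / 2 : ℂ) + γ' * I) l lam ((1 / 2 : ℂ) + τ * I)‖ ≤
          Lof lam ^ l * ((2 / |τ - γ'| + l ! * D') * 8) := by
        refine hk'.trans ?_
        rw [show Lof lam ^ l * ((2 / |τ - γ'| + l ! * D') * 8) = 8 * (Lof lam ^ l * (l ! * D') +
          Lof lam ^ l * (2 / |τ - γ'|)) by ring]
        refine mul_le_mul hr (add_le_add ?_ ?_) (by positivity) (by norm_num)
        · exact le_mul_of_one_le_left (by positivity) (one_le_pow₀ hL1)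
        · exact mul_le_mul_of_nonneg_left (min_le_right _ _) (by positivity)
      calc (Lof lam ^ (k + l + 1))⁻¹ * (‖burnolKk ((1 / 2 : ℂ) + γ * I) k lam ((1 / 2 : ℂ) + τ * I)‖ *
            ‖burnolKk ((1 / 2 : ℂ) + γ' * I) l lam ((1 / 2 : ℂ) + τ * I)‖)
          ≤ (Lof lam ^ (k + l + 1))⁻¹ * ((Lof lam ^ k * ((2 / |τ - γ| + k ! * D) * 8)) *
              (Lof lam ^ l * ((2 / |τ - γ'| + l ! * D') * 8))) := by gcongr
        _ = (Lof lam)⁻¹ * B' := by rw [hB']; field_simp; ring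

/-! ## 6. The pairing of the `k = 0` datum (the tree's `-burnolK`) -/

/-- **The `k = 0` pairing** (Burnol, Thm. 5.3: "`lim √(log(1/λ)) (χ₁, X^λ_{ρ,0}) = (ρ-1)/ρ²`", Mellin
side, from the tree's `tendsto_integral_burnolK1_div`/`tendsto_integral_burnolK2_div` and
`K_0 = -burnolK`): `∫ K_0(s)/s dτ → -2π (ρ-1)/ρ⁵` as `λ → 0⁺`. [cite: Burnol2002, Thm. 5.3] -/
theorem tendsto_integral_burnolKk_zero_div (γ : ℝ) :
    Tendsto (fun lam : ℝ ↦ ∫ τ : ℝ,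
        burnolKk ((1 / 2 : ℂ) + γ * I) 0 lam ((1 / 2 : ℂ) + τ * I) / ((1 / 2 : ℂ) + τ * I))
      (𝓝[>] 0) (𝓝 (-(2 * π * ((((1 / 2 : ℂ) + γ * I) - 1) / ((1 / 2 : ℂ) + γ * I) ^ 5)))) := by
  have h := ((tendsto_integral_burnolK1_div γ).add (tendsto_integral_burnolK2_div γ)).neg
  rw [add_zero] at h
  refine h.congr' ?_
  filter_upwards [eventually_mem_Ioo] with lam hlam
  rw [← (integral_burnolK_div_eq_add hlam.1 γ).2, ← integral_neg]
  refine integral_congr_ae ?_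
  filter_upwards [ae_ne γ] with τ hτ
  have hsρ : (1 / 2 : ℂ) + τ * I ≠ (1 / 2 : ℂ) + γ * I := fun h ↦ hτ (by
    have := congrArg Complex.im h; simpa using this)
  rw [burnolKk_zero hlam.1 hlam.2 (by simp) (by simp; norm_num) hsρ, neg_div]

/-- **Integrability of `K_k(s)/s` on the line** (`0 < λ < 1`). [folklore] -/
theorem integrable_burnolKk_div {lam : ℝ} (h0 : 0 < lam) (h1 : lam < 1) (γ : ℝ) (k : ℕ) :
    Integrable fun τ : ℝ ↦
      burnolKk ((1 / 2 : ℂ) + γ * I) k lam ((1 / 2 : ℂ) + τ * I) / ((1 / 2 : ℂ) + τ * I) :=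
  integrable_div_line (integrable_burnolKk_line h0 h1 γ k).1 (measurable_burnolKk_line γ k lam)

/-! ## 7. Parseval for two inverse Mellin transforms of `L¹ ∩ L²` line data -/

/-- Cast bookkeeping on the line: `((1/2 : ℝ) : ℂ) + iy = 1/2 + iy`. [folklore] -/
lemma ofReal_half_add (y : ℝ) : (((1 / 2 : ℝ) : ℂ) + y * I) = (1 / 2 : ℂ) + y * I := by
  push_cast; ring

/-- The inverse-Mellin integrand at `σ = 1/2`, `x > 0`, is integrable as soon as the line datum is.
[folklore] -/
lemma integrable_mellinInv_integrand {F : ℂ → ℂ} (hF : Integrable fun τ : ℝ ↦ F ((1 / 2 : ℂ) + τ * I))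
    {x : ℝ} (hx : 0 < x) :
    Integrable fun y : ℝ ↦ (x : ℂ) ^ (-(((1 / 2 : ℝ) : ℂ) + y * I)) • F (((1 / 2 : ℝ) : ℂ) + y * I) := by
  have e : (fun y : ℝ ↦ (x : ℂ) ^ (-(((1 / 2 : ℝ) : ℂ) + y * I)) • F (((1 / 2 : ℝ) : ℂ) + y * I)) =
      fun y : ℝ ↦ (x : ℂ) ^ (-(((1 / 2 : ℝ) : ℂ) + y * I)) • F ((1 / 2 : ℂ) + y * I) := by
    funext y; rw [ofReal_half_add]
  rw [e]
  refine (hF.norm.const_mul (x ^ (-(1 / 2 : ℝ)))).mono' ?_ (Eventually.of_forall fun y ↦ ?_)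
  · exact (by fun_prop : Measurable fun y : ℝ ↦ (x : ℂ) ^ (-(((1 / 2 : ℝ) : ℂ) + y * I))).aestronglyMeasurable.smul hF.1
  · rw [norm_smul, norm_cpow_eq_rpow_re_of_pos hx]
    simp

/-- **Linearity of `𝓜⁻¹` on `(0,∞)`**: `𝓜⁻¹(G + cF) = 𝓜⁻¹G + c 𝓜⁻¹F` for integrable line data.
[folklore] -/
theorem mellinInv_add_const_mul {F G : ℂ → ℂ} (hF : Integrable fun τ : ℝ ↦ F ((1 / 2 : ℂ) + τ * I))
    (hG : Integrable fun τ : ℝ ↦ G ((1 / 2 : ℂ) + τ * I)) (c : ℂ) {x : ℝ} (hx : 0 < x) :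
    mellinInv (1 / 2) (fun s ↦ G s + c * F s) x = mellinInv (1 / 2) G x + c * mellinInv (1 / 2) F x := by
  simp only [mellinInv]
  have h1 := integrable_mellinInv_integrand hF hx
  have h2 := integrable_mellinInv_integrand hG hx
  simp only [smul_eq_mul] at h1 h2 ⊢
  simp_rw [mul_add]
  rw [integral_add h2 (by simpa [mul_left_comm] using h1.const_mul c)]
  rw [show (fun a : ℝ ↦ (x : ℂ) ^ (-(((1 / 2 : ℝ) : ℂ) + a * I)) * (c * F (((1 / 2 : ℝ) : ℂ) + a * I))) =
    fun a : ℝ ↦ c * ((x : ℂ) ^ (-(((1 / 2 : ℝ) : ℂ) + a * I)) * F (((1 / 2 : ℝ) : ℂ) + a * I)) by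
    funext a; ring, integral_const_mul, Complex.real_smul, Complex.real_smul, Complex.real_smul]
  ring

/-- **Parseval for two inverse Mellin transforms** (polarisation of the tree's Plancherel identity
`integral_norm_sq_mellinInv`): for `L¹ ∩ L²` data `F, G` on the critical line,
`∫_0^∞ 𝓜⁻¹F · conj(𝓜⁻¹G) dt = (1/2π) ∫ F(1/2+iτ) conj(G(1/2+iτ)) dτ`. [folklore] -/
theorem integral_mellinInv_mul_conj_mellinInv {F G : ℂ → ℂ}
    (hF1 : Integrable fun τ : ℝ ↦ F ((1 / 2 : ℂ) + τ * I))
    (hF2 : MemLp (fun τ : ℝ ↦ F ((1 / 2 : ℂ) + τ * I)) 2)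
    (hG1 : Integrable fun τ : ℝ ↦ G ((1 / 2 : ℂ) + τ * I))
    (hG2 : MemLp (fun τ : ℝ ↦ G ((1 / 2 : ℂ) + τ * I)) 2) :
    ∫ t in Ioi (0 : ℝ), mellinInv (1 / 2) F t * conj (mellinInv (1 / 2) G t) =
      (1 / (2 * π) : ℂ) * ∫ τ : ℝ, F ((1 / 2 : ℂ) + τ * I) * conj (G ((1 / 2 : ℂ) + τ * I)) := by
  obtain ⟨hFm, hFn⟩ := integral_norm_sq_mellinInv hF1 hF2
  obtain ⟨hGm, hGn⟩ := integral_norm_sq_mellinInv hG1 hG2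
  -- polarisation with `u = G`, `v = F` on the line and `U = 𝓜⁻¹G`, `V = 𝓜⁻¹F` on `(0,∞)`
  have hpol := integral_conj_mul_eq_of_norm_sq (μ := (volume : Measure ℝ))
    (ν := volume.restrict (Ioi (0 : ℝ))) (K := 1 / (2 * π)) hG2 hF2 hGm hFm hGn hFn ?_
  · -- translate `conj(U) V` and `conj(u) v` back
    have e1 : ∫ t in Ioi (0 : ℝ), mellinInv (1 / 2) F t * conj (mellinInv (1 / 2) G t) =
        ∫ t in Ioi (0 : ℝ), conj (mellinInv (1 / 2) G t) * mellinInv (1 / 2) F t :=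
      integral_congr_ae (Eventually.of_forall fun t ↦ mul_comm _ _)
    have e2 : ∫ τ : ℝ, F ((1 / 2 : ℂ) + τ * I) * conj (G ((1 / 2 : ℂ) + τ * I)) =
        ∫ τ : ℝ, conj (G ((1 / 2 : ℂ) + τ * I)) * F ((1 / 2 : ℂ) + τ * I) :=
      integral_congr_ae (Eventually.of_forall fun τ ↦ mul_comm _ _)
    rw [e1, e2, hpol]
    push_cast
    ring
  · intro c _
    have h1 : Integrable fun τ : ℝ ↦ G ((1 / 2 : ℂ) + τ * I) + c * F ((1 / 2 : ℂ) + τ * I) :=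
      hG1.add (hF1.const_mul c)
    have h2 : MemLp (fun τ : ℝ ↦ G ((1 / 2 : ℂ) + τ * I) + c * F ((1 / 2 : ℂ) + τ * I)) 2 :=
      hG2.add (hF2.const_mul c)
    obtain ⟨-, hn⟩ := integral_norm_sq_mellinInv (M := fun s ↦ G s + c * F s) h1 h2
    rw [← hn]
    refine setIntegral_congr_fun measurableSet_Ioi fun t ht ↦ ?_
    rw [mellinInv_add_const_mul hF1 hG1 c ht]

end BurnolVectors

end Literature.NumberTheory.LFunctions
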